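import Summits.QuantumFields.QCD.Theses.HeatSlicedQuarks
import Summits.QuantumFields.QCD.Theses.GradientFlowSpecies
import Summits.QuantumFields.QCD.Theses.AnomalyRigidity
import Summits.QuantumFields.QCD.Theorems.RobustYangMillsHandover.Negative.ChiralityObstruction
import Summits.QuantumFields.QCD.Theorems.HeatSlicedQuarksRobustYangMillsHandoverLeeYangCertificate
import Summits.QuantumFields.QCD.Theorems.HeatSlicedQuarksRobustYangMillsHandoverStubAnomalyGermVanishes
import Summits.QuantumFields.QCD.Theorems.HeatSlicedQuarksRobustYangMillsHandoverStubTreeDecayBoundsGerm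
import Summits.QuantumFields.QCD.Theorems.HeatSlicedQuarksRobustYangMillsHandoverStubFarMomentsBoundGerm
import Literature.MathematicalPhysics.QuantumFieldTheory.MassGapFromLatticeClustering
import Literature.MathematicalPhysics.QuantumFieldTheory.MassGapToLatticeClustering
import Literature.MathematicalPhysics.QuantumFieldTheory.TransferTruncatedSchwarzBound
import Literature.MathematicalPhysics.QuantumFieldTheory.TransferDecayUpgrade
import Summits.QuantumFields.QCD.Theorems.SpectralDefectExtinctionWindowExtinctionChessboardDeepAsymptotics

/-!
# Line `lee-yang-mass-handover` — skeleton (lead c5 gen 4 / 4.1; lead c6 gen 4.2; lead c7 gen 4.3; lead c8 gen 4.4; lead c10 gen 5 / 5.1, 2026-08-17T01:xxZ: AnomalyRigidity rev 6 — 17719 PROVED p132696, 17718 reshaped at super-logarithmic volumes, free by `enlargeL`)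

Crux `stmt-QuantumFields-8892`,
`Summit.QuantumFields.QCD.Theses.HeatSlicedQuarks.RobustYangMillsHandover := ContinuumQCDExists → QCD`,
after the statement re-type p117723 (`QCDOf N_f` conjoins `reg.IsChiralAtZero`).

## Gen 4 (lead c5): the light half re-cut along the card's own `Leans on:` (route `AnomalyRigidity`)

Gen 2/3 (lead a2) registered five stubs: `stub_opensBelow` (mechanism-free light-quark interface), `stub_heavyHalf`
(= item 8922), `stub_gaplessTuple` (Goldstone I), `stub_pinnedData`, `stub_latticeToSpeciesCS`; its transparency lemmas
(`opensBelow_iff_noUniformRateAbovePin`, `isChiralAtZero_shiftReg_iff`, kept in §5) showed that at the pin every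
`OpensBelow` supplier — the Lee–Yang certificate (landed, `LeeYangCertificate.opensBelow_of_leeYangOpenness`) and r2k4's
`DiagonalResponse` alike — is EQUIVALENT to the chirality clause of the pinned regularisation: certified, never reduced,
and backed by no item.  Gen 4 therefore supplies chirality at the pin by the one MECHANISM the tree holds for the
re-typed clause, which the lee-yang card itself lists under `Leans on:` for its TIP — the anomaly rigidity chain of route
`AnomalyRigidity` (items 16259–16262, filed 18:12Z):

* NEW `stub_wardTripleAtPin` — part (b) of the existing crux `AnomalyRigidity.AnomalousWardTriple` (stmt-16259)
  instantiated at the PINNED regularisation `shiftReg reg (sInf (gappedOffsets reg))`: an anomalous Ward triple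
  `V_μ, A_λ, P` with mass-independent weights on the degenerate ray `m ∈ (0, 1]` above the pin (convergent torus
  transforms, `B₄` pseudo-covariance, transversality, differentiability at zero momentum, the anomalous Ward germ with
  `c ≠ 0`, m-uniform local moment bounds and truncated reflected pair bounds) PLUS the two centring clauses the
  18:44Z route review of 16260 asks such data to export (vanishing one-point functions of `V_μ` and `P`).  Physically:
  the pin IS the PCAC-critical point (the Ward germ reads `κ·m·Γ^P` with `m` the offset above the pin).
* NEW `stub_uniformGapTreeDecayCentered` — item 16260 `UniformGapTreeDecay` with the two centring hypotheses added
  (the review's repair: as typed, `V = P = 1` is a counterexample); implied by 16260 as typed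
  (`uniformGapTreeDecayCentered_of_uniformGapTreeDecay`), equal to it once repaired that way.
* `stub_treeDecayBoundsGerm` = item 16261, `stub_anomalyGermVanishes` = item 16262 (provable-now) BY NAME.
* `isChiralAtZero_of_wardTripleDataCentered` (§3, proved: replay of `AnomalyRigidity.closes`) turns these four into
  chirality of the pinned regularisation; so BOTH itemless Goldstone stubs of gen 2 leave the registered path:
  `stub_opensBelow` (now a COROLLARY, `opensBelow_of_stubs`, §5) and `stub_gaplessTuple` (gaps above `sInf` need only
  NON-EMPTINESS of the gapped offsets, i.e. item 8922 — `pin_latticeGapped` never used `BddBelow`).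
* `stub_pinnedData` loses its idle `BddBelow` hypothesis; `stub_latticeToSpeciesCS` is REPAIRED: restricted to the
  species renormalisations `(z, shift)` that carry `IsQCDAlong` data (the only ones `honestGappedDataAbove_of_pinnedData`
  consumes; for arbitrary `z(k) → ∞` the `ε`-slack of `ClustersCS` is not scale-invariant, so the gen-2 form
  over-claimed).

## Gen 4.2 (lead c6, 2026-08-16T21:5xZ)

* `stub_treeDecayBoundsGerm` (= item 16261) LANDED p127308 and is imported (item 16261 closed `proved`).
* RESHAPE of `stub_uniformGapTreeDecayCentered` on its wave-1 audit (evidence #108): the extra hypothesis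
  `∀ᶠ k, 0 ≤ reg.β k` (the RP / transfer-matrix route needs `β ≥ 0`; truth for `β < 0` is unknown and irrelevant) —
  supplied free by the consumer (`eventually_beta_nonneg_of_honestDataAboveZero`, from `IsQCDAlong` through the landed
  `deep_tendsto_beta_atTop`, `N_f ≤ 16`).  Open stubs: `stub_heavyHalf` (= 8922), `stub_pinnedData`,
  `stub_latticeToSpeciesCS`, `stub_wardTripleAtPin`, `stub_uniformGapTreeDecayCentered`.

## Gen 4.3 (lead c7, 2026-08-16T23:0xZ) — no stub change; §8 records the mechanism audit of `stub_uniformGapTreeDecayCentered`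

* LANDED p129979 `Literature/MathematicalPhysics/QuantumFieldTheory/TransferTruncatedSchwarzBound.lean` (imported): the
  gap-free truncated Cauchy–Schwarz bound `|⟪u,T^t v⟫ − ⟪u,Ω⟫⟪Ω,v⟫|² ≤ (Re⟪u,T^t u⟫ − |⟪Ω,u⟫|²)(‖v‖² − |⟪Ω,v⟫|²)` for a
  positive transfer operator (`TransferData.norm_inner_pow_sub_sq_le`, `…_le_of_diag`, OS-measure forms).  Consequence for
  the stub (§8): of c6's missing pieces M1–M7 the spectral-gap extraction M3 — the step at which the per-pair thresholds of
  `HasLatticeMassGap` (8923's G4) would be fatal — is NOT needed: cut the centred three-point function by a time hyperplane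
  into an isolated observable and a pair; the bound uses ONE diagonal pair per observable (five pairs, one `k₀`) and the
  stub's own uniform truncated reflected pair bounds.  What remains is M1+M6 alone: a transfer/OS realisation of the
  finite-`S` PERIODIC functional `qcdTorusExpect` — which is a `(−1)^F`-twisted trace, not a state (§8 docstring).

## Gen 4.4 (lead c8, 2026-08-16T23:5xZ) — no stub change; two engines; §9 records the FINITE-TORUS audit of `stub_uniformGapTreeDecayCentered`

* LANDED p131005 `Literature/MathematicalPhysics/QuantumFieldTheory/TransferDecayUpgrade.lean` (imported): the per-vector
  DECAY UPGRADE for a positive transfer operator — log-convexity of `n ↦ ⟪v, Tⁿ v⟫`; an EVENTUAL diagonal bound `≤ K rⁿ`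
  with ANY constant forces `⟪v, T^{n+1} v⟫ ≤ r ⟪v, Tⁿ v⟫` for every `n`, hence decay from any `n₀` with the honest constant
  (the value at `n₀`) and full-rate mixed clustering with truncated-norm constants; `IsOSRealisation` measure forms.  This
  discharges c7's "second positivity use" (§8: the per-pair constants `C_{A,B}` of `HasLatticeMassGap` are for unweighted
  observables while the weights `u(k)² ~ a_k⁻⁶` diverge) IN INFINITE TIME EXTENT: `threePoint_le_of_centred_of_eventually`
  (§9).
* LANDED p131779 `Literature/Probability/LatticeModels/OSReconstructionAbstract.lean` (+ p131961 `OSReconstructionMeasure.lean`,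
  review-queued): the Osterwalder–Schrader / GNS reconstruction itself (the construction `TransferOperator.lean` deferred):
  PSD Hermitian form + symmetric orbit-bounded endomorphism ⇒ Hilbert space, dense `ι`, iterated Schwarz ⇒ contraction,
  positive transfer operator, `TransferData`; RP measure data ⇒ `IsOSRealisation` (one-step with positive shift, two-step
  always).  This is the infrastructure of §9's repair option 2 (thermodynamic limit first).
* LANDED p131329 `Literature/Analysis/Convex/LogConvexSequenceChord.lean`: the finite-range counterpart — on a finite range
  only the chord survives, `g j ^ M ≤ g 0 ^ (M−j) · g M ^ j`, and an endpoint constant `W` is harmless at a slower rate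
  iff `log W ≲ M log (r'/r)`.
* §9: on the stub's actual FINITE tori three findings beyond c7's M1 — (b1) the antiperiodic functional has PROVED
  site-RP at finite `S` (`WilsonQCDSiteReflectionPositivityAP_holds`), so the Schwarz cut needs no transfer operator there;
  (b2) per-pair constants versus weights at antipodal separations need `log (u_k² C) ≤ (ε−ε') a_k L_k` — a volume
  growth-rate / weight condition absent from item 16260 and from `QCDRegularisation`, with an abstract slow-mode scenario
  showing no RP/transfer-matrix architecture can do without it; (b3) time-antiperiodicity alone breaks the hypercubic
  symmetry at finite `S` (no spatial cuts).  Open stubs unchanged: `stub_heavyHalf` (= 8922), `stub_pinnedData`,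
  `stub_latticeToSpeciesCS`, `stub_wardTripleAtPin`, `stub_uniformGapTreeDecayCentered`.

## Gen 5 / 5.1 (lead c10, 2026-08-17T00:2xZ–01:xxZ) — tracks route `AnomalyRigidity` rev 6; 17719 LANDED; 17718 RESHAPED at super-logarithmic volumes

Rev 6 of `AnomalyRigidity` (23:28Z) restated the chain this line leans on: crux #3 `UniformGapTreeDecay` (16260,
misstated for the unit observable) is superseded by `UniformGapFarMoments` (item 17718: the L¹ far-region weighted-moment
form, CENTRED, with `N_f ∈ {2,3}` and two-loop asymptotic scaling among the hypotheses) and `FarMomentsBoundGerm` (item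
17719, provable-now); `AnomalousWardTriple` (17716) now exports the two centring clauses — its part (b) is, clause by
clause, this file's `WardTripleDataCentered` (the item's `Ev Q` abbreviation unfolded), so `stub_wardTripleAtPin` is
unchanged.  Accordingly (gen 5, stub names as registered by the parallel seat c9 at 23:56Z):
* `stub_uniformGapTreeDecayCentered : UniformGapTreeDecayCentered` (skeleton-local centred 16260) is RETIRED together with
  its `def` and `uniformGapTreeDecayCentered_of_uniformGapTreeDecay`.
* NEW `stub_farMomentsBoundGerm : FarMomentsBoundGerm` = item 17719 BY NAME — PROVED this cycle
  (`Theorems/HeatSlicedQuarksRobustYangMillsHandoverStubFarMomentsBoundGerm.lean`, p132696, commit a7f9f012227f, item 17719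
  closed `proved`: near box of radius `max R₀ 1` and far region cover `box²`, global moments `≤ C_near + C_far`, then the
  landed `treeGerm_germ_bound_of_moments`); imported like 16261/16262.
* Gen 5.1 RESHAPE of the 17718 stub: `stub_uniformGapFarMomentsLV : UniformGapFarMomentsLV` := item 17718 VERBATIM plus ONE
  extra hypothesis (H-vol) `a_k L_k / log (2 + a_k⁻¹ + |u_V(k)| + |u_P(k)|) → ∞` (super-logarithmic physical volumes relative
  to the inverse spacing and the weights).  WHY (§10): 17718 as typed inherits lead c8's finite-torus obstruction (§9 (b2)) —
  its hypotheses carry no volume-rate datum (`QCDRegularisation.tendsto_L` is `a_k L_k → ∞` at an arbitrary rate) and admit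
  the abstract slow-mode scenario with weights `u(k) ≥ e^{ε a_k L_k/2}`; (H-vol) is exactly what kills it.  AND IT IS FREE:
  every hypothesis of the chain and the use of its conclusion are eventual statements over all tori `S ≥ L_k`, so they
  survive ENLARGING the thresholds `L_k ↦ L'_k ≥ L_k`, and super-logarithmic `L'` always exist (`enlargeL`,
  `exists_superlogVolume`); §3 `isChiralAtZero_of_wardTripleDataCentered` is now proved — sorry-free, kernel-checked —
  from the LV stub through the volume-enlarged regularisation.  17718 BY NAME still suffices
  (`uniformGapFarMomentsLV_of_uniformGapFarMoments`); the honest restatement of 17718 for route `AnomalyRigidity` is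
  `UniformGapFarMomentsLV` (its `closes` goes through verbatim by the same enlargement).
* §3 `isChiralAtZero_of_wardTripleDataCentered` replays the rev-6 deciding theorem `AnomalyRigidity.closes` for a GIVEN
  regularisation (extra inputs `N_f = 2 ∨ N_f = 3` and `(reg.scheme 0 0 0).HasAsymptoticScaling`, the latter read off
  `IsQCDAlong` exactly like the physical branch); `stub_treeDecayBoundsGerm` (16261, landed) leaves the deciding path.
Open stubs: `stub_heavyHalf` (= 8922), `stub_pinnedData`, `stub_latticeToSpeciesCS`, `stub_wardTripleAtPin`,
`stub_uniformGapFarMomentsLV` (= 17718 + H-vol); closed this cycle: `stub_farMomentsBoundGerm` (= 17719).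

## The composition (sorry-free outside the `stub_*` theorems of §1)

Fix `N_f ∈ {2, 3}` and the regularisation `reg` X₀ hands over (`HasMassScaling` + `HonestDataAboveZero reg`).
HEAD = THE PIN (pure logic, r2k4): `P := sInf (gappedOffsets reg)`; gaps above the pin are free from NON-EMPTINESS
(`stub_heavyHalf` = 8922); the physical branch and asymptotic scaling at the degenerate tuples of the pinned regularisation
come from `stub_pinnedData`; chirality at the pin from `stub_wardTripleAtPin` + 17718ᴸⱽ + 17719 + 16262 (through the volume-enlarged
pinned regularisation); honest gapped data
above the pin from `stub_pinnedData` + `stub_latticeToSpeciesCS` + the landed transfer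
`IsQCDAlong.hasMassGap_of_hasSpeciesCSClustering`.  `RobustYangMillsHandover_of` closes the crux BY NAME from the six
stubs (three of them existing items by name: 8922, 17719, 16262; one = 17718 + the free (H-vol); one the pinned instance of
17716(b)).
-/

namespace Summit.QuantumFields.QCD.Cruxes.RobustYangMillsHandover.LeeYangMassHandover

open Summit.QuantumFields.QCD.Theses.HeatSlicedQuarks
open Summit.QuantumFields.QCD.Theses.AnomalyRigidity
open Summit.QuantumFields.QCD.Theorems.RobustYangMillsHandover.Negative
open Literature.MathematicalPhysics.QuantumFieldTheory
open Filter

noncomputable section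

variable {Nf : ℕ}

/-! ## §0 Definitions (skeleton-local `Prop` abbreviations) -/

/-- The lattice theory of `reg` at the offset tuple `t` is gapped at SOME positive uniform rate. -/
def LatticeGappedAt (reg : QCDRegularisation Nf) (t : Fin Nf → ℝ) : Prop :=
  ∃ Δ > (0 : ℝ), (reg.scheme t 0 0).HasLatticeMassGap Δ

/-- Offsets `M` above which EVERY tuple is lattice-gapped (pointwise rates). An up-set. -/
def gappedOffsets (reg : QCDRegularisation Nf) : Set ℝ :=
  {M | ∀ t : Fin Nf → ℝ, (∀ f, M < t f) → LatticeGappedAt reg t}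

/-- The `m_crit`-shift by the renormalised offset `M`. -/
def shiftReg (reg : QCDRegularisation Nf) (M : ℝ) : QCDRegularisation Nf :=
  { reg with mcrit := fun k => reg.mcrit k + reg.a k * M / reg.Zm k }

/-- **Opens below** (gen-2 interface, kept for the certificates of §5): a UNIFORM lattice gap `ε` at every tuple above
the offset `M` forces SOME positive rate at every tuple of a slab just below `M`. -/
def OpensBelow (reg : QCDRegularisation Nf) : Prop :=
  ∀ M : ℝ, (∃ ε > (0 : ℝ), ∀ t : Fin Nf → ℝ, (∀ f, M < t f) → (reg.scheme t 0 0).HasLatticeMassGap ε) →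
    ∃ δ > (0 : ℝ), ∀ t : Fin Nf → ℝ, (∀ f, M - δ < t f) → LatticeGappedAt reg t

/-- X₀'s data for `reg`: honest continuum QCD at every positive mass tuple (no gap clauses). -/
def HonestDataAboveZero (reg : QCDRegularisation Nf) : Prop :=
  ∀ m : Fin Nf → ℝ, (∀ f, 0 < m f) →
    ∃ (z shift : QCDField Nf → ℕ → ℝ) (T : OSData (QCDField Nf) 4),
      IsQCDAlong (reg.scheme m z shift) T ∧ T.IsNontrivial QCDField.glue ∧ T.IsNonGaussian QCDField.glue ∧
        ∀ f g : Fin Nf, f ≠ g → T.IsNontrivial (QCDField.pseudoRe f g)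

/-- Honest GAPPED continuum data at every offset tuple above `P`. -/
def HonestGappedDataAbove (reg : QCDRegularisation Nf) (P : ℝ) : Prop :=
  ∀ t : Fin Nf → ℝ, (∀ f, P < t f) →
    ∃ (z shift : QCDField Nf → ℕ → ℝ) (T : OSData (QCDField Nf) 4),
      IsQCDAlong (reg.scheme t z shift) T ∧ T.IsNontrivial QCDField.glue ∧ T.IsNonGaussian QCDField.glue ∧
        (∀ f g : Fin Nf, f ≠ g → T.IsNontrivial (QCDField.pseudoRe f g)) ∧ ∃ Δ > 0, T.HasMassGap Δ

/-- **Lee–Yang openness of `reg`** (the line's name-giving CERTIFICATE, gen 1–3; sufficient for `OpensBelow` by the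
landed `LeeYangCertificate.opensBelow_of_leeYangOpenness`, see `opensBelow_of_leeYang` in §5): a uniform lattice gap
`ε` above the offset `M` yields `δ₀ ∈ (0, 1]` such that every connected Euclidean-time correlator at the tuples of the
slab `> M − δ₀` is the value at `0` of a function analytic and bounded by `K` on the Bernstein ellipse of complex
flavour-blind shifts (foci `1, 3`, left vertex `−δ₀`) and bounded by `K e^{−ε a_k n}` on the heavy anchor `[1, 3]`. -/
def LeeYangOpenness (reg : QCDRegularisation Nf) : Prop :=
  ∀ (M ε : ℝ), 0 < ε →
    (∀ t : Fin Nf → ℝ, (∀ f, M < t f) → (reg.scheme t 0 0).HasLatticeMassGap ε) →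
      ∃ δ₀ : ℝ, 0 < δ₀ ∧ ∀ t : Fin Nf → ℝ, (∀ f, M - δ₀ < t f) →
        ∀ (R R' : ℕ) (A : QCDLatticeObservable Nf R) (B : QCDLatticeObservable Nf R'),
          ∃ K : ℝ, ∀ᶠ k in atTop, ∀ S : ℕ, reg.L k ≤ S → ∀ n : ℕ, n ≤ S →
            ∃ h : ℂ → ℂ,
              DifferentiableOn ℂ h ((fun z : ℂ => 2 + (z + z⁻¹) / 2) ''
                {z : ℂ | 1 ≤ ‖z‖ ∧ ‖z‖ < (2 + δ₀) + Real.sqrt ((2 + δ₀) ^ 2 - 1)}) ∧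
              (∀ s ∈ (fun z : ℂ => 2 + (z + z⁻¹) / 2) ''
                {z : ℂ | 1 ≤ ‖z‖ ∧ ‖z‖ < (2 + δ₀) + Real.sqrt ((2 + δ₀) ^ 2 - 1)}, ‖h s‖ ≤ K) ∧
              (∀ s : ℝ, s ∈ Set.Icc (1 : ℝ) 3 → ‖h s‖ ≤ K * Real.exp (-(ε * (reg.a k * n)))) ∧
              h 0 = qcdLatticeConnectedCorr (reg.β k) (2 * S + 1) (fun f => (reg.scheme t 0 0).mq f k) A B n

/-- **Anomalous Ward-triple data for the regularisation `reg` on the degenerate ray `m ∈ (0, 1]`, CENTRED** — part (b)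
of `AnomalyRigidity.AnomalousWardTriple` (item stmt-QuantumFields-16259) VERBATIM for a GIVEN `reg` (local lattice
observables `V_μ, A_λ, P` of quark box 1, mass-independent weights `u_V, u_A, u_P`, limits `Γ_m, Γ^P_m`, a constant
`c ≠ 0` and `κ > 0`: convergence of the physical-momentum torus transforms of `u³⟨V_μ V_ν A_λ⟩`, `u³⟨V_μ V_ν P⟩`,
`B₄` pseudo-covariance, bi-transversality and differentiability of `Γ_m` at zero momentum, the anomalous Ward germ
`(p+q)·Γ_m − κ m Γ^P_m − c·ε(p,q) = o(|k|²)`, m-uniform local weighted-moment bounds, m-uniform truncated reflected pair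
bounds of the family `{1, V_μ, P}`), conjoined with the two CENTRING clauses (vanishing one-point functions of `V_μ` and
of `P` at every `m ∈ (0, 1]`, eventually in `k`, on every torus `S ≥ L_k`) that the route review of 16260 (18:44Z)
requires such data to export. [cite: KarstenSmit1981] [cite: ColemanGrossman1982] -/
def WardTripleDataCentered (reg : QCDRegularisation Nf) : Prop :=
  open Literature.MathematicalPhysics.QuantumFieldTheory Literature.Probability.LatticeModels in ∃ (V A : Fin 4 → QCDLatticeObservable Nf 1) (P : QCDLatticeObservable Nf 1) (uV uA uP : ℕ → ℝ) (Γ : ℝ → (Fin 4 → ℝ) → (Fin 4 → ℝ) → Fin 4 → Fin 4 → Fin 4 → ℂ) (ΓP : ℝ → (Fin 4 → ℝ) → (Fin 4 → ℝ) → Fin 4 → Fin 4 → ℂ) (c : ℂ) (κ : ℝ), let ph := fun (k : ℕ) (x : Fin 4 → ℤ) (i : Fin 4) => reg.a k * (x i : ℝ); let E := fun (k S : ℕ) (m : ℝ) X => qcdTorusExpect (reg.β k) (2 * S + 1) (fun fl => (reg.scheme (fun _ : Fin Nf => m) 0 0).mq fl k) X; let C3 := fun (k S : ℕ) (m : ℝ)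 (X Y Z : QCDLatticeObservable Nf 1) x y => E k S m (fun U => X.onTorus (2 * S + 1) x U * Y.onTorus (2 * S + 1) y U * Z.onTorus (2 * S + 1) 0 U); let F3 := fun (k S : ℕ) (m : ℝ) X Y Z (a b d : ℕ → ℝ) (p q : Fin 4 → ℝ) => ((reg.a k ^ 8 : ℝ) : ℂ) * ∑ x ∈ box 4 S, ∑ y ∈ box 4 S, Complex.exp (Complex.I * ((∑ i : Fin 4, (p i * ph k x i + q i * ph k y i) : ℝ) : ℂ)) * ((a k * b k * d k : ℝ) : ℂ) * C3 k S m X Y Z x y; let O := fun o : Option (Fin 4 ⊕ Unit) => Option.elim o (QCDLatticeObservable.one Nf 1) (Sum.elim V (fun _ : Unit => P)); let w := fun o : Option (Fin 4 ⊕ Unit) => Option.elim o (fun _ : ℕ => (1 : ℝ)) (Sum.elim (fun _ : Fin 4 => uV) (fun _ : Unit => uP)); let R2 := fun (S : ℕ) (X Y : QCDLatticeObservable Nf 1) x y U => Y.osAdjoint.onTorus (2 * S + 1) (siteReflect y) U * X.osAdjoint.onTorus (2 * S + 1) (siteReflect x) U; let P2 := fun (S : ℕ) (X Y : QCDLatticeObservable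 Nf 1) x y U => X.onTorus (2 * S + 1) x U * Y.onTorus (2 * S + 1) y U; let V8 := (Fin 4 → ℝ) × (Fin 4 → ℝ); let q2 := fun k : V8 => ‖k‖ ^ 2; c ≠ 0 ∧ 0 < κ ∧ (∀ m : ℝ, 0 < m → m ≤ 1 → ((∀ p q μ ν la, ∀ δ : ℝ, 0 < δ → ∀ᶠ k in Filter.atTop, ∀ S : ℕ, reg.L k ≤ S → ‖F3 k S m (V μ) (V ν) (A la) uV uV uA p q - Γ m p q μ ν la‖ ≤ δ) ∧ (∀ p q μ ν, ∀ δ : ℝ, 0 < δ → ∀ᶠ k in Filter.atTop, ∀ S : ℕ, reg.L k ≤ S → ‖F3 k S m (V μ) (V ν) P uV uV uP p q - ΓP m p q μ ν‖ ≤ δ) ∧ (∀ R : Matrix (Fin 4) (Fin 4) ℝ, (∀ i j, R i j = 0 ∨ R i j = 1 ∨ R i j = -1) → R * R.transpose = 1 → ∀ (p q : (Fin 4 → ℝ)) μ ν la, Γ m (R.mulVec p) (R.mulVec q) μ ν la = ((R.det : ℝ) : ℂ) * ∑ μ', ∑ ν', ∑ la', ((R μ μ' * R ν ν' * R la la' :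 ℝ) : ℂ) * Γ m p q μ' ν' la') ∧ (∀ ν la, (fun k : V8 => ∑ μ : Fin 4, ((k.1 μ : ℝ) : ℂ) * Γ m k.1 k.2 μ ν la) =o[nhds 0] q2) ∧ (∀ μ la, (fun k : V8 => ∑ ν : Fin 4, ((k.2 ν : ℝ) : ℂ) * Γ m k.1 k.2 μ ν la) =o[nhds 0] q2) ∧ (∀ μ ν la, DifferentiableAt ℝ (fun k : V8 => Γ m k.1 k.2 μ ν la) 0) ∧ (∀ μ ν, (fun k : V8 => (∑ la : Fin 4, ((k.1 la + k.2 la : ℝ) : ℂ) * Γ m k.1 k.2 μ ν la) - ((κ * m : ℝ) : ℂ) * ΓP m k.1 k.2 μ ν - c * ((Matrix.det (Matrix.of ![Pi.single μ 1, Pi.single ν 1, k.1, k.2]) : ℝ) : ℂ)) =o[nhds 0] q2))) ∧ (∀ Rl : ℝ, 0 < Rl → ∃ C : ℝ, ∀ m : ℝ, 0 < m → m ≤ 1 → ∀ (i j : ℕ), 1 ≤ i → i ≤ 2 → 1 ≤ j → j ≤ 2 → ∀ μ ν : Fin 4, ∀ᶠ k in Filter.atTop, ∀ S : ℕ, reg.L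 k ≤ S → (∑ x ∈ box 4 S, ∑ y ∈ box 4 S, if ‖ph k x‖ ≤ Rl ∧ ‖ph k y‖ ≤ Rl then reg.a k ^ 8 * ‖ph k x‖ ^ i * ‖ph k y‖ ^ j * ‖((uV k * uV k * uP k : ℝ) : ℂ) * C3 k S m (V μ) (V ν) P x y‖ else 0) ≤ C) ∧ (∃ σ : ℝ, σ < 4 ∧ ∀ τ : ℝ, 0 < τ → ∃ C : ℝ, ∀ m : ℝ, 0 < m → m ≤ 1 → ∀ ι₁ ι₂ : Option (Fin 4 ⊕ Unit), ∀ᶠ k in Filter.atTop, ∀ S : ℕ, reg.L k ≤ S → ∀ x ∈ box 4 S, ∀ y ∈ box 4 S, τ ≤ ph k x 0 → τ ≤ ph k y 0 → ‖ph k x‖ ≤ τ⁻¹ → ‖ph k y‖ ≤ τ⁻¹ → ‖(((w ι₁ k * w ι₂ k) ^ 2 : ℝ) : ℂ) * (E k S m (fun U => R2 S (O ι₁) (O ι₂) x y U * P2 S (O ι₁) (O ι₂) x y U) - E k S m (R2 S (O ι₁) (O ι₂) x y) * E k S m (P2 S (O ι₁) (O ι₂) x y))‖ ≤ C * (reg.a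 k + ‖ph k x - ph k y‖) ^ (-(2 * σ))) ∧ (∀ m : ℝ, 0 < m → m ≤ 1 → ∀ μ : Fin 4, ∀ᶠ k in Filter.atTop, ∀ S : ℕ, reg.L k ≤ S → ∀ x ∈ box 4 S, E k S m ((V μ).onTorus (2 * S + 1) x) = 0) ∧ (∀ m : ℝ, 0 < m → m ≤ 1 → ∀ᶠ k in Filter.atTop, ∀ S : ℕ, reg.L k ≤ S → ∀ x ∈ box 4 S, E k S m (P.onTorus (2 * S + 1) x) = 0)

/-- **`UniformGapFarMoments` at SUPER-LOGARITHMIC VOLUMES** (gen 5.1, lead c10) — item stmt-QuantumFields-17718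
`AnomalyRigidity.UniformGapFarMoments` VERBATIM with ONE extra hypothesis inserted before the conclusion: the physical volume
grows super-logarithmically relative to the inverse spacing and to the weights,
`a_k L_k / log (2 + a_k⁻¹ + |u_V(k)| + |u_P(k)|) → ∞` (H-vol).  WHY: lead c8's finite-torus audit (§9 (b2)) and its gen-5
sharpening (§10): on the tori `S ≥ L_k` the hypotheses of 17718 (per-pair gap constants for UNWEIGHTED observables, weighted
truncated reflected pair bounds, centring, asymptotic scaling) admit an abstract spectral scenario — one exactly degenerate
slow mode with overlaps `≤ C e^{−ε a_k S / 2}` and weights `u(k) ≥ e^{ε a_k L_k / 2}` — under which the weighted three-point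
function is `O(1)` pointwise WITHOUT decay, so its far-region L¹ moments grow like `(a_k L_k)^{8+i+j}`; the scenario dies
exactly when `ε a_k L_k ≫ log |u(k)|`, which no hypothesis of 17718 provides (`QCDRegularisation.tendsto_L` is `a_k L_k → ∞`
at an arbitrary rate).  The extra hypothesis is FREE for every consumer: all hypotheses and the use of the conclusion are
monotone under ENLARGING the volume thresholds `L_k ↦ L'_k ≥ L_k` (`enlargeL`, `exists_superlogVolume`,
`isChiralAtZero_of_wardTripleDataCentered` below), so 17718 restated this way closes route `AnomalyRigidity` and this line
verbatim.  Implied by 17718 as typed (`uniformGapFarMomentsLV_of_uniformGapFarMoments`). [cite: Luscher1977]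
[cite: OsterwalderSeiler1978, §§2–4] -/
def UniformGapFarMomentsLV : Prop :=
  open Literature.MathematicalPhysics.QuantumFieldTheory Literature.Probability.LatticeModels in ∀ (Nf : ℕ) (reg : QCDRegularisation Nf) (V : Fin 4 → QCDLatticeObservable Nf 1) (P : QCDLatticeObservable Nf 1) (uV uP : ℕ → ℝ) (ε m₁ : ℝ), let ph := fun (k : ℕ) (x : Fin 4 → ℤ) (i : Fin 4) => reg.a k * (x i : ℝ); let E := fun (k S : ℕ) (m : ℝ) X => qcdTorusExpect (reg.β k) (2 * S + 1) (fun fl => (reg.scheme (fun _ : Fin Nf => m) 0 0).mq fl k) X; let C3 := fun (k S : ℕ) (m : ℝ) (X Y Z : QCDLatticeObservable Nf 1) x y => E k S m (fun U => X.onTorus (2 * S + 1) x U * Y.onTorus (2 * S + 1) y U * Z.onTorus (2 * S + 1) 0 U); let O := fun o : Option (Fin 4 ⊕ Unit) => Option.elim o (QCDLatticeObservable.one Nf 1) (Sum.elim V (fun _ : Unit => P)); let w := fun o : Option (Fin 4 ⊕ Unit) => Option.elim o (fun _ : ℕ => (1 : ℝ)) (Sum.elim (fun _ : Fin 4 =>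 uV) (fun _ : Unit => uP)); let R2 := fun (S : ℕ) (X Y : QCDLatticeObservable Nf 1) x y U => Y.osAdjoint.onTorus (2 * S + 1) (siteReflect y) U * X.osAdjoint.onTorus (2 * S + 1) (siteReflect x) U; let P2 := fun (S : ℕ) (X Y : QCDLatticeObservable Nf 1) x y U => X.onTorus (2 * S + 1) x U * Y.onTorus (2 * S + 1) y U; (∃ σ : ℝ, σ < 4 ∧ ∀ τ : ℝ, 0 < τ → ∃ C : ℝ, ∀ m : ℝ, 0 < m → m ≤ 1 → ∀ ι₁ ι₂ : Option (Fin 4 ⊕ Unit), ∀ᶠ k in Filter.atTop, ∀ S : ℕ, reg.L k ≤ S → ∀ x ∈ box 4 S, ∀ y ∈ box 4 S, τ ≤ ph k x 0 → τ ≤ ph k y 0 → ‖ph k x‖ ≤ τ⁻¹ → ‖ph k y‖ ≤ τ⁻¹ → ‖(((w ι₁ k * w ι₂ k) ^ 2 : ℝ) : ℂ) * (E k S m (fun U => R2 S (O ι₁) (O ι₂) x y U * P2 S (O ι₁) (O ι₂) x y U) - E k S m (R2 S (O ι₁) (O ι₂) x y) * E k S m (P2 S (O ι₁) (O ι₂)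 x y))‖ ≤ C * (reg.a k + ‖ph k x - ph k y‖) ^ (-(2 * σ))) → 0 < ε → 0 < m₁ → m₁ ≤ 1 → (∀ m : ℝ, 0 < m → m ≤ m₁ → (reg.scheme (fun _ : Fin Nf => m) 0 0).HasLatticeMassGap ε) → (∀ m : ℝ, 0 < m → m ≤ m₁ → ∀ fl : Fin Nf, ∀ᶠ k in Filter.atTop, (-1 : ℝ) < (reg.scheme (fun _ : Fin Nf => m) 0 0).mq fl k) → Nf = 2 ∨ Nf = 3 → (reg.scheme 0 0 0).HasAsymptoticScaling → (∀ m : ℝ, 0 < m → m ≤ m₁ → ∀ μ : Fin 4, ∀ᶠ k in Filter.atTop, ∀ S : ℕ, reg.L k ≤ S → ∀ x ∈ box 4 S, E k S m ((V μ).onTorus (2 * S + 1) x) = 0) → (∀ m : ℝ, 0 < m → m ≤ m₁ → ∀ᶠ k in Filter.atTop, ∀ S : ℕ, reg.L k ≤ S → ∀ x ∈ box 4 S, E k S m (P.onTorus (2 * S + 1) x) = 0) → Filter.Tendsto (fun k : ℕ => reg.a k * (reg.L k : ℝ) / Real.log (2 + (reg.a k)⁻¹ + |uV k| + |uP k|))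 Filter.atTop Filter.atTop → (∃ R₀ C : ℝ, ∀ m : ℝ, 0 < m → m ≤ m₁ → ∀ (i j : ℕ), 1 ≤ i → i ≤ 2 → 1 ≤ j → j ≤ 2 → ∀ μ ν : Fin 4, ∀ᶠ k in Filter.atTop, ∀ S : ℕ, reg.L k ≤ S → (∑ x ∈ box 4 S, ∑ y ∈ box 4 S, if R₀ ≤ max ‖ph k x‖ ‖ph k y‖ then reg.a k ^ 8 * ‖ph k x‖ ^ i * ‖ph k y‖ ^ j * ‖((uV k * uV k * uP k : ℝ) : ℂ) * C3 k S m (V μ) (V ν) P x y‖ else 0) ≤ C)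

/-! ## §1 The registered stubs (the only `sorry`s of the line) -/

/-- **stub_heavyHalf — the heavy-threshold lattice half, BY NAME** (item stmt-QuantumFields-8922,
`GradientFlowSpecies.MassiveLatticeGap`: for every X₀-honest regularisation there is a threshold above which every
tuple is lattice-gapped at some rate — non-emptiness of `gappedOffsets`; open, unclaimed; proved modulo `stub_twoScaleYM`
+ items 14667, 8693 by the gen-4 two-scale skeleton's `massiveLatticeGap_of_stubs`). -/
theorem stub_heavyHalf : Summit.QuantumFields.QCD.Theses.GradientFlowSpecies.MassiveLatticeGap := by
  sorry

/-- **stub_pinnedData — honest continuum data for the PINNED regularisation** (gen 2, idle `BddBelow` hypothesis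
dropped): at every positive mass tuple of `shiftReg reg P`, `P = sInf (gappedOffsets reg)` — i.e. at every offset tuple
of `reg` above the pin — honest continuum QCD data with the three non-triviality clauses exist.  X₀ supplies them at the
offsets `> 0` (`honestDataAboveZero_shiftReg_of_nonneg` covers `P ≥ 0`, in particular the junk pin `sInf = 0` of an
unbounded-below up-set); the NEW content sits at the gapped offsets in `(P, 0]`, present only when X₀'s witness sits
strictly above the chiral point: light-quark continuum existence below X₀'s own offset (crux-sized; a2 wave-1 audit). -/
theorem stub_pinnedData :
    ∀ (Nf : ℕ), (Nf = 2 ∨ Nf = 3) → ∀ reg : QCDRegularisation Nf, reg.HasMassScaling →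
      HonestDataAboveZero reg → (gappedOffsets reg).Nonempty →
        HonestDataAboveZero (shiftReg reg (sInf (gappedOffsets reg))) := by
  sorry

/-- **stub_latticeToSpeciesCS — lattice gap ⇒ species Cauchy–Schwarz clustering, for the HONEST species
renormalisations** (gen 2 stub repaired: restricted to the `(z, shift)` that carry `IsQCDAlong` data — the only instance
the composition consumes; pair clustering of bounded LOCAL observables with per-pair constants versus CS clustering of
Schwartz-smeared species PRODUCTS — Lüscher transfer-matrix spectral reading, 8923-type kernel; the continuum gap is then
the landed `IsQCDAlong.hasMassGap_of_hasSpeciesCSClustering`). -/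
theorem stub_latticeToSpeciesCS :
    ∀ (Nf : ℕ), (Nf = 2 ∨ Nf = 3) → ∀ reg : QCDRegularisation Nf, reg.HasMassScaling →
      HonestDataAboveZero reg → ∀ t : Fin Nf → ℝ, LatticeGappedAt reg t →
        ∀ (z shift : QCDField Nf → ℕ → ℝ) (T : OSData (QCDField Nf) 4), IsQCDAlong (reg.scheme t z shift) T →
          ∃ Δ > (0 : ℝ), (reg.scheme t z shift).HasSpeciesCSClustering Δ := by
  sorry

/-- **stub_wardTripleAtPin — the anomalous Ward triple of the PINNED regularisation** (NEW, gen 4; replaces the itemless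
`stub_opensBelow` + `stub_gaplessTuple`): for the regularisation X₀ hands over, with non-empty gapped offsets, the
regularisation shifted by the infimum of its gapped offsets carries centred anomalous Ward-triple data on the degenerate
ray `(0, 1]` above the pin (`WardTripleDataCentered`) — part (b) of item 16259 at OUR regularisation; the pin is then the
PCAC-critical point.  Open physics (non-perturbative control of the subtracted PCAC insertion uniformly as `m → 0⁺`,
Karsten–Smit anomaly of Wilson fermions); the bet of gen 4. -/
theorem stub_wardTripleAtPin :
    ∀ (Nf : ℕ), (Nf = 2 ∨ Nf = 3) → ∀ reg : QCDRegularisation Nf, reg.HasMassScaling →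
      HonestDataAboveZero reg → (gappedOffsets reg).Nonempty →
        WardTripleDataCentered (shiftReg reg (sInf (gappedOffsets reg))) := by
  sorry

/-- **stub_uniformGapFarMomentsLV — uniform gap ⇒ m-uniform FAR-REGION weighted moments of the centred three-point
function, at super-logarithmic volumes** (gen 5.1 RESHAPE of `stub_uniformGapFarMoments` = item stmt-QuantumFields-17718:
the item VERBATIM plus the free hypothesis (H-vol), see `UniformGapFarMomentsLV`; 17718 BY NAME still suffices,
`uniformGapFarMomentsLV_of_uniformGapFarMoments`).  Held by the lead.  What a proof needs (c6–c8 audits, unchanged): an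
RP transfer / OS realisation of the PERIODIC finite-torus functional `qcdTorusExpect` with Wilson fermions (or its
thermodynamic limit plus wrap-around control), the landed truncated Schwarz / decay-upgrade engines (p129979, p131005) for
the m-uniform infinite-extent decay, and exponential finite-size control on `S ≥ L_k` — which is where (H-vol) is spent. -/
theorem stub_uniformGapFarMomentsLV : UniformGapFarMomentsLV := by
  sorry

/- **stub_farMomentsBoundGerm — item stmt-QuantumFields-17719 BY NAME: LANDED** (lead c10, p132696,
`Theorems/HeatSlicedQuarksRobustYangMillsHandoverStubFarMomentsBoundGerm.lean`, commit a7f9f012227f: near box of radius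
`max R₀ 1` + far region cover `box²`, global `(i,j)`-moments `≤ C_near + C_far` eventually on every `S ≥ L_k`, then the landed
`treeGerm_germ_bound_of_moments`).  Imported above under the same fully-qualified name
`…LeeYangMassHandover.stub_farMomentsBoundGerm : FarMomentsBoundGerm`; no `sorry` here any more. -/

/- **stub_treeDecayBoundsGerm — item stmt-QuantumFields-16261 BY NAME: LANDED** (lead c6, p127308,
`Theorems/HeatSlicedQuarksRobustYangMillsHandoverStubTreeDecayBoundsGerm.lean`, commit aa59124875b1; item 16261 closed
`proved` 21:42Z; near/far split of the global weighted moments: local moment hypothesis at radius `max R₀ 1`, far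
region by tree decay + `treeGerm_far_weight_sum` (engines p126867/p126870 of lead c5), then
`treeGerm_germ_bound_of_moments`).  Imported above under the same fully-qualified name
`…LeeYangMassHandover.stub_treeDecayBoundsGerm : TreeDecayBoundsGerm`; no `sorry` here any more. -/

/- **stub_anomalyGermVanishes — item stmt-QuantumFields-16262 BY NAME: LANDED** (wave 2, worker W1, p126118,
`Theorems/HeatSlicedQuarksRobustYangMillsHandoverStubAnomalyGermVanishes.lean`, commit c72cf5e11b35; the Euclidean
Coleman–Grossman germ lemma, covariance hypothesis unused).  Imported above under the same fully-qualified name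
`…LeeYangMassHandover.stub_anomalyGermVanishes : AnomalyGermVanishes`; no `sorry` here any more. -/

/-! ## §2 Elementary facts about the pin objects (a2, kept) -/

/-- `gappedOffsets` is an up-set. [folklore] -/
theorem gappedOffsets_upper {reg : QCDRegularisation Nf} {M M' : ℝ} (hM : M ∈ gappedOffsets reg)
    (h : M ≤ M') : M' ∈ gappedOffsets reg :=
  fun t ht => hM t fun f => lt_of_le_of_lt h (ht f)

/-- The shifted scheme at `m` is the original scheme at `M + m`. [folklore] -/
theorem shiftReg_scheme (reg : QCDRegularisation Nf) (M : ℝ) (m : Fin Nf → ℝ)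
    (z shift : QCDField Nf → ℕ → ℝ) :
    (shiftReg reg M).scheme m z shift = reg.scheme (fun f => M + m f) z shift := by
  simp only [QCDRegularisation.scheme, shiftReg, QCDScheme.mk.injEq, true_and, and_true]
  funext f k
  ring

/-- The shift keeps `HasMassScaling` (which never reads `m_crit`). [folklore] -/
theorem shiftReg_hasMassScaling_iff (reg : QCDRegularisation Nf) (M : ℝ) :
    (shiftReg reg M).HasMassScaling ↔ reg.HasMassScaling :=
  Iff.rfl

/-- A finite tuple of positive reals has a positive lower bound. [folklore] -/
theorem exists_pos_le_all (m : Fin Nf → ℝ) (hm : ∀ f, 0 < m f) : ∃ δ > (0 : ℝ), ∀ f, δ ≤ m f := by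
  rcases isEmpty_or_nonempty (Fin Nf) with hE | hN
  · exact ⟨1, one_pos, fun f => (hE.false f).elim⟩
  · obtain ⟨f₀, -, hf₀⟩ := Finset.exists_min_image Finset.univ m Finset.univ_nonempty
    exact ⟨m f₀, hm f₀, fun f => hf₀ f (Finset.mem_univ f)⟩

/-- Monotonicity of the lattice gap clause in the rate. [folklore] -/
theorem hasLatticeMassGap_anti (sch : QCDScheme Nf) {Δ Δ' : ℝ} (hle : Δ ≤ Δ')
    (h : sch.HasLatticeMassGap Δ') : sch.HasLatticeMassGap Δ := by
  intro R R' A B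
  obtain ⟨C, hC⟩ := h R R' A B
  refine ⟨C, ?_⟩
  filter_upwards [hC] with k hk S hS n hn
  refine (hk S hS n hn).trans ?_
  have hC0 : 0 ≤ C := by
    have h1 := (norm_nonneg _).trans (hk S hS n hn)
    exact nonneg_of_mul_nonneg_left h1 (Real.exp_pos _)
  refine mul_le_mul_of_nonneg_left (Real.exp_le_exp.mpr ?_) hC0
  have : 0 ≤ sch.a k * n := mul_nonneg (sch.a_pos k).le (Nat.cast_nonneg n)
  nlinarith

/-- Monotonicity of the continuum gap clause in the rate. [folklore] -/
theorem hasMassGap_anti {ι : Type} {d : ℕ} [NeZero d] (T : OSData ι d) {Δ Δ' : ℝ} (hle : Δ ≤ Δ')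
    (h : T.HasMassGap Δ') : T.HasMassGap Δ := by
  intro n m k k' F G hF hG
  obtain ⟨C, hC⟩ := h n m k k' F G hF hG
  refine ⟨C, fun t ht H hH => (hC t ht H hH).trans ?_⟩
  have hC0 : 0 ≤ C := by
    have h1 := (norm_nonneg _).trans (hC t ht H hH)
    exact nonneg_of_mul_nonneg_left h1 (Real.exp_pos _)
  exact mul_le_mul_of_nonneg_left (Real.exp_le_exp.mpr (by nlinarith)) hC0

/-- Every tuple strictly above the infimum of the (non-empty) gapped offsets is lattice-gapped — NO `BddBelow` needed
(if the up-set is all of `ℝ` the infimum is Lean's junk `0` and the conclusion holds a fortiori). [folklore] -/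
theorem latticeGappedAt_of_above_sInf (reg : QCDRegularisation Nf) (hne : (gappedOffsets reg).Nonempty)
    (t : Fin Nf → ℝ) (ht : ∀ f, sInf (gappedOffsets reg) < t f) : LatticeGappedAt reg t := by
  obtain ⟨δ, hδ, hδm⟩ :=
    exists_pos_le_all (fun f => t f - sInf (gappedOffsets reg)) (fun f => by linarith [ht f])
  obtain ⟨M, hMS, hMlt⟩ :=
    exists_lt_of_csInf_lt hne (show sInf (gappedOffsets reg) < sInf (gappedOffsets reg) + δ by linarith)
  exact hMS t fun f => by linarith [hδm f]

/-- **Gaps above the pin are free**: every positive tuple of the regularisation shifted by the infimum of its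
gapped offsets is lattice-gapped. [folklore] -/
theorem pin_latticeGapped (reg : QCDRegularisation Nf) (hne : (gappedOffsets reg).Nonempty)
    (m : Fin Nf → ℝ) (hm : ∀ f, 0 < m f) :
    LatticeGappedAt (shiftReg reg (sInf (gappedOffsets reg))) m := by
  obtain ⟨Δ, hΔ, hL⟩ := latticeGappedAt_of_above_sInf reg hne (fun f => sInf (gappedOffsets reg) + m f)
    (fun f => by linarith [hm f])
  exact ⟨Δ, hΔ, by rw [shiftReg_scheme]; exact hL⟩

/-- X₀'s data survive an upward (non-negative) shift of `m_crit`: the case `P ≥ 0` of `stub_pinnedData` is free.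
[folklore] -/
theorem honestDataAboveZero_shiftReg_of_nonneg (reg : QCDRegularisation Nf) (hX : HonestDataAboveZero reg)
    {P : ℝ} (hP : 0 ≤ P) : HonestDataAboveZero (shiftReg reg P) := by
  intro m hm
  obtain ⟨z, shift, T, hA, hN, hG, hPs⟩ := hX (fun f => P + m f) (fun f => by linarith [hm f])
  exact ⟨z, shift, T, by rw [shiftReg_scheme]; exact hA, hN, hG, hPs⟩

/-- The physical-branch clause at the degenerate tuples of ANY regularisation carrying honest data above zero
(`IsQCDAlong` reads it off; the bare masses do not depend on the species renormalisations). [folklore] -/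
theorem branch_of_honestDataAboveZero (reg : QCDRegularisation Nf) (hX : HonestDataAboveZero reg) :
    ∀ m : ℝ, 0 < m → m ≤ 1 → ∀ fl : Fin Nf, ∀ᶠ k in atTop,
      (-1 : ℝ) < (reg.scheme (fun _ : Fin Nf => m) 0 0).mq fl k := by
  intro m hm _ fl
  obtain ⟨z, shift, T, hT, -⟩ := hX (fun _ => m) (fun _ => hm)
  exact hT.2.1 fl

/-! ## §3 The anomaly tip: chirality from centred Ward-triple data (replay of `AnomalyRigidity.closes`) -/

/-- 17718 as typed implies its super-logarithmic-volume instance (the extra hypothesis is simply not used). [folklore] -/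
theorem uniformGapFarMomentsLV_of_uniformGapFarMoments (h : UniformGapFarMoments) : UniformGapFarMomentsLV := by
  intro Nf reg V P uV uP ε m₁ ph E C3 O w R2 P2 hU2 hε hm₁ hm₁1 hgap hbranch hNf hAS hcV hcP _
  exact h Nf reg V P uV uP ε m₁ hU2 hε hm₁ hm₁1 hgap hbranch hNf hAS hcV hcP

/-- Eventual statements "for all tori `S ≥ L_k`" are monotone under enlarging the volume thresholds. [folklore] -/
theorem eventually_forall_ge_mono {L L' : ℕ → ℕ} (hL : ∀ k, L k ≤ L' k) {Q : ℕ → ℕ → Prop}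
    (h : ∀ᶠ k in atTop, ∀ S : ℕ, L k ≤ S → Q k S) : ∀ᶠ k in atTop, ∀ S : ℕ, L' k ≤ S → Q k S :=
  h.mono fun k hk S hS => hk S ((hL k).trans hS)

/-- **Volume enlargement**: the same regularisation with larger volume thresholds `L'_k ≥ L_k` (spacings, couplings,
critical mass and `Z_m` unchanged; `a_k L'_k → ∞` a fortiori). -/
abbrev enlargeL (reg : QCDRegularisation Nf) (L' : ℕ → ℕ) (hL : ∀ k, reg.L k ≤ L' k) : QCDRegularisation Nf :=
  { reg with
    L := L'
    tendsto_L := tendsto_atTop_mono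
      (fun k => mul_le_mul_of_nonneg_left (Nat.cast_le.mpr (hL k)) (reg.a_pos k).le) reg.tendsto_L }

/-- **Super-logarithmic volumes exist above any thresholds**: for spacings `a_k → 0⁺`, thresholds `L_k` and any weights
there are `L'_k ≥ L_k` with `a_k L'_k / log (2 + a_k⁻¹ + |u_V(k)| + |u_P(k)|) → ∞`
(`L'_k := max L_k ⌈log² (…) / a_k⌉`). [folklore] -/
theorem exists_superlogVolume (a : ℕ → ℝ) (ha : ∀ k, 0 < a k) (hat : Tendsto a atTop (nhds 0)) (L : ℕ → ℕ)
    (uV uP : ℕ → ℝ) : ∃ L' : ℕ → ℕ, (∀ k, L k ≤ L' k) ∧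
      Tendsto (fun k : ℕ => a k * (L' k : ℝ) / Real.log (2 + (a k)⁻¹ + |uV k| + |uP k|)) atTop atTop := by
  set g : ℕ → ℝ := fun k => 2 + (a k)⁻¹ + |uV k| + |uP k| with hg
  have hg2 : ∀ k, 2 ≤ g k := fun k => by
    have h1 : 0 ≤ (a k)⁻¹ := inv_nonneg.mpr (ha k).le
    have h2 : 0 ≤ |uV k| := abs_nonneg _
    have h3 : 0 ≤ |uP k| := abs_nonneg _
    simp only [hg]; linarith
  have hlog_pos : ∀ k, 0 < Real.log (g k) := fun k => Real.log_pos (by linarith [hg2 k])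
  refine ⟨fun k => max (L k) ⌈Real.log (g k) ^ 2 / a k⌉₊, fun k => le_max_left _ _, ?_⟩
  -- `g k → ∞`, hence `log (g k) → ∞`
  have hginv : Tendsto (fun k => (a k)⁻¹) atTop atTop :=
    tendsto_inv_nhdsGT_zero.comp (tendsto_nhdsWithin_iff.mpr ⟨hat, Eventually.of_forall fun k => ha k⟩)
  have hgt : Tendsto g atTop atTop := by
    refine tendsto_atTop_mono (fun k => ?_) hginv
    have h2 : 0 ≤ |uV k| := abs_nonneg _
    have h3 : 0 ≤ |uP k| := abs_nonneg _
    simp only [hg]; linarith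
  have hlogt : Tendsto (fun k => Real.log (g k)) atTop atTop := Real.tendsto_log_atTop.comp hgt
  refine tendsto_atTop_mono (fun k => ?_) hlogt
  -- `a_k L'_k ≥ log² g_k`, so the ratio is `≥ log g_k`
  have hak := ha k
  have hceil : Real.log (g k) ^ 2 / a k ≤ (⌈Real.log (g k) ^ 2 / a k⌉₊ : ℝ) := Nat.le_ceil _
  have hmax : (⌈Real.log (g k) ^ 2 / a k⌉₊ : ℝ) ≤ ((max (L k) ⌈Real.log (g k) ^ 2 / a k⌉₊ : ℕ) : ℝ) := by
    exact_mod_cast le_max_right _ _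
  have hprod : Real.log (g k) ^ 2 ≤ a k * ((max (L k) ⌈Real.log (g k) ^ 2 / a k⌉₊ : ℕ) : ℝ) := by
    calc Real.log (g k) ^ 2 = a k * (Real.log (g k) ^ 2 / a k) := by field_simp
      _ ≤ a k * ((max (L k) ⌈Real.log (g k) ^ 2 / a k⌉₊ : ℕ) : ℝ) :=
          mul_le_mul_of_nonneg_left (hceil.trans hmax) hak.le
  rw [le_div_iff₀ (hlog_pos k)]
  calc Real.log (g k) * Real.log (g k) = Real.log (g k) ^ 2 := by ring
    _ ≤ _ := hprod

/-- **Chirality from the anomaly** (pure logic; the replay of the rev-6 deciding theorem `AnomalyRigidity.closes` for a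
GIVEN regularisation, through the VOLUME-ENLARGED regularisation `enlargeL reg L'`): centred Ward-triple data on the ray
`(0, 1]`, the physical branch and two-loop asymptotic scaling there, the uniform-gap ⇒ far-moments transfer AT
SUPER-LOGARITHMIC VOLUMES (`UniformGapFarMomentsLV`, the gen-5.1 reshape of 17718), the moments ⇒ bounded-germ lemma (17719)
and the germ lemma (16262) make `reg` chiral at zero.  Every hypothesis is an eventual statement over all tori `S ≥ L_k`,
hence survives `L_k ↦ L'_k ≥ L_k`; the negation of `IsChiralAtZero reg` is a uniform lattice gap at all positive tuples
on all tori `S ≥ L_k ⊇ {S ≥ L'_k}`, which feeds the chain for `enlargeL reg L'` and forces `c = 0`.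
[cite: ColemanGrossman1982] [cite: tHooft1980Naturalness] -/
theorem isChiralAtZero_of_wardTripleDataCentered (hNf : Nf = 2 ∨ Nf = 3) (reg : QCDRegularisation Nf)
    (hbranch : ∀ m : ℝ, 0 < m → m ≤ 1 → ∀ fl : Fin Nf, ∀ᶠ k in atTop,
      (-1 : ℝ) < (reg.scheme (fun _ : Fin Nf => m) 0 0).mq fl k)
    (hAS : (reg.scheme 0 0 0).HasAsymptoticScaling)
    (hW : WardTripleDataCentered reg) (h3 : UniformGapFarMomentsLV) (h4 : FarMomentsBoundGerm)
    (h9 : AnomalyGermVanishes) : reg.IsChiralAtZero := by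
  obtain ⟨V, A, P, uV, uA, uP, Γ, ΓP, c, κ, hc, hκ, hper, hU1, hU2, hcV, hcP⟩ := hW
  by_contra hchi
  apply hc
  unfold QCDRegularisation.IsChiralAtZero at hchi
  push Not at hchi
  obtain ⟨ε, hε, hgap⟩ := hchi
  -- enlarge the volume thresholds
  obtain ⟨L', hL, hvol⟩ := exists_superlogVolume reg.a reg.a_pos reg.tendsto_a reg.L uV uP
  set reg' : QCDRegularisation Nf := enlargeL reg L' hL with hreg'
  have hgap' : ∀ m : ℝ, 0 < m → m ≤ 1 →
      (reg'.scheme (fun _ : Fin Nf => m) 0 0).HasLatticeMassGap ε := by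
    intro m hm _ R R' A' B'
    obtain ⟨C, hC⟩ := hgap (fun _ => m) (fun _ => hm) R R' A' B'
    exact ⟨C, eventually_forall_ge_mono hL hC⟩
  have hbranch' : ∀ m : ℝ, 0 < m → m ≤ 1 → ∀ fl : Fin Nf, ∀ᶠ k in atTop,
      (-1 : ℝ) < (reg'.scheme (fun _ : Fin Nf => m) 0 0).mq fl k := hbranch
  have hAS' : (reg'.scheme 0 0 0).HasAsymptoticScaling := hAS
  have hcV' := fun m hm hm1 μ => eventually_forall_ge_mono hL (hcV m hm hm1 μ)
  have hcP' := fun m hm hm1 => eventually_forall_ge_mono hL (hcP m hm hm1)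
  obtain ⟨σ, hσ, hU2σ⟩ := hU2
  have hfar := h3 Nf reg' V P uV uP ε 1
    ⟨σ, hσ, fun τ hτ => by
      obtain ⟨C, hC⟩ := hU2σ τ hτ
      exact ⟨C, fun m hm hm1 ι₁ ι₂ => eventually_forall_ge_mono hL (hC m hm hm1 ι₁ ι₂)⟩⟩
    hε one_pos le_rfl hgap' hbranch' hNf hAS' hcV' hcP' hvol
  obtain ⟨K, hK⟩ := h4 Nf reg' V P uV uP ΓP 1 one_pos le_rfl
    (fun m hm hm1 p q μ ν δ hδ => eventually_forall_ge_mono hL ((hper m hm hm1).2.1 p q μ ν δ hδ))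
    (fun Rl hRl => by
      obtain ⟨C, hC⟩ := hU1 Rl hRl
      exact ⟨C, fun m hm hm1 i j hi1 hi2 hj1 hj2 μ ν =>
        eventually_forall_ge_mono hL (hC m hm hm1 i j hi1 hi2 hj1 hj2 μ ν)⟩)
    hfar
  exact h9 Γ ΓP c κ K 1 one_pos hκ.le (fun m hm hm1 =>
    ⟨(hper m hm hm1).2.2.1, (hper m hm hm1).2.2.2.1, (hper m hm hm1).2.2.2.2.1,
      (hper m hm hm1).2.2.2.2.2.1, (hper m hm hm1).2.2.2.2.2.2, hK m hm hm1⟩)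

/-- Along any regularisation carrying honest data above zero the scheme scales asymptotically (`IsQCDAlong` reads it off
at the tuple `1`; the clause only depends on `β_k, a_k`). [folklore] -/
theorem hasAsymptoticScaling_of_honestDataAboveZero (reg : QCDRegularisation Nf) (hX : HonestDataAboveZero reg) :
    (reg.scheme 0 0 0).HasAsymptoticScaling := by
  obtain ⟨z, shift, T, hT, -⟩ := hX (fun _ => 1) (fun _ => one_pos)
  exact hT.1

/-- Along any regularisation carrying honest data above zero with `N_f ≤ 16` the inverse bare coupling is eventually
non-negative (`IsQCDAlong ⟹ HasAsymptoticScaling ⟹ β_k → +∞`, landed `deep_tendsto_beta_atTop`). [folklore] -/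
theorem eventually_beta_nonneg_of_honestDataAboveZero (hNf : Nf ≤ 16) (reg : QCDRegularisation Nf)
    (hX : HonestDataAboveZero reg) : ∀ᶠ k in atTop, (0 : ℝ) ≤ reg.β k := by
  obtain ⟨z, shift, T, hT, -⟩ := hX (fun _ => 1) (fun _ => one_pos)
  exact (Summit.QuantumFields.QCD.Cruxes.WindowExtinction.ChessboardColdCells.deep_tendsto_beta_atTop hNf
    (reg.scheme (fun _ => 1) z shift) hT.1).eventually_ge_atTop 0

/-- **Chirality at the pin from the four light stubs** (gen 5: 17716(b) at the pin, 17718, 17719, 16262). [folklore] -/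
theorem pin_isChiralAtZero_of_anomaly (hNf : Nf = 2 ∨ Nf = 3) (reg : QCDRegularisation Nf)
    (hpin : HonestDataAboveZero (shiftReg reg (sInf (gappedOffsets reg))))
    (hW : WardTripleDataCentered (shiftReg reg (sInf (gappedOffsets reg))))
    (h3 : UniformGapFarMomentsLV) (h4 : FarMomentsBoundGerm) (h9 : AnomalyGermVanishes) :
    (shiftReg reg (sInf (gappedOffsets reg))).IsChiralAtZero :=
  isChiralAtZero_of_wardTripleDataCentered hNf _ (branch_of_honestDataAboveZero _ hpin)
    (hasAsymptoticScaling_of_honestDataAboveZero _ hpin) hW h3 h4 h9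

/-! ## §4 Assembly: `QCDOf N_f` from the pin, and the crux BY NAME -/

/-- **Gapped honest data above the pin** from data for the pinned regularisation, the lattice-to-species-CS kernel
(honest renormalisations) and the LANDED continuum transfer `IsQCDAlong.hasMassGap_of_hasSpeciesCSClustering`.
[folklore] -/
theorem honestGappedDataAbove_of_pinnedData (reg : QCDRegularisation Nf) (hne : (gappedOffsets reg).Nonempty)
    (hpin : HonestDataAboveZero (shiftReg reg (sInf (gappedOffsets reg))))
    (hCS : ∀ t : Fin Nf → ℝ, LatticeGappedAt reg t →
      ∀ (z shift : QCDField Nf → ℕ → ℝ) (T : OSData (QCDField Nf) 4), IsQCDAlong (reg.scheme t z shift) T →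
        ∃ Δ > (0 : ℝ), (reg.scheme t z shift).HasSpeciesCSClustering Δ) :
    HonestGappedDataAbove reg (sInf (gappedOffsets reg)) := by
  set P := sInf (gappedOffsets reg) with hP
  intro t ht
  have hL : LatticeGappedAt reg t := latticeGappedAt_of_above_sInf reg hne t ht
  obtain ⟨z, shift, T, hA, hN, hG, hPs⟩ := hpin (fun f => t f - P) (fun f => by linarith [ht f])
  rw [shiftReg_scheme] at hA
  have ht' : (fun f => P + (t f - P)) = t := funext fun f => by ring
  rw [ht'] at hA
  obtain ⟨Δ, hΔ, hcs⟩ := hCS t hL z shift T hA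
  exact ⟨z, shift, T, hA, hN, hG, hPs, Δ, hΔ, hA.hasMassGap_of_hasSpeciesCSClustering hcs⟩

/-- **`QCDOf N_f` from the pin**, chirality supplied directly (gen 4). [folklore] -/
theorem qcdOf_of_pin (reg : QCDRegularisation Nf) (hMS : reg.HasMassScaling)
    (hne : (gappedOffsets reg).Nonempty) (hchi : (shiftReg reg (sInf (gappedOffsets reg))).IsChiralAtZero)
    (hdata : HonestGappedDataAbove reg (sInf (gappedOffsets reg))) : QCDOf Nf := by
  set P := sInf (gappedOffsets reg) with hP
  refine ⟨shiftReg reg P, (shiftReg_hasMassScaling_iff reg P).mpr hMS, hchi, fun m hm => ?_⟩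
  obtain ⟨z, shift, T, hA, hN, hG, hPs, Δ₁, hΔ₁, hT⟩ := hdata (fun f => P + m f) (fun f => by linarith [hm f])
  obtain ⟨Δ₂, hΔ₂, hL⟩ := pin_latticeGapped reg hne m hm
  refine ⟨z, shift, T, ?_, hN, hG, hPs, min Δ₁ Δ₂, lt_min hΔ₁ hΔ₂, hasMassGap_anti T (min_le_left _ _) hT, ?_⟩
  · rw [shiftReg_scheme]; exact hA
  · exact (hasLatticeMassGap_species_irrel _ m z shift _).mpr (hasLatticeMassGap_anti _ (min_le_right _ _) hL)

/-- Non-emptiness of the gapped offsets of an X₀-honest regularisation, from the heavy half (8922). [folklore] -/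
theorem gappedOffsets_nonempty (h : Summit.QuantumFields.QCD.Theses.GradientFlowSpecies.MassiveLatticeGap)
    (hNf : Nf = 2 ∨ Nf = 3) (reg : QCDRegularisation Nf) (hMS : reg.HasMassScaling)
    (hX : HonestDataAboveZero reg) : (gappedOffsets reg).Nonempty := by
  obtain ⟨M, hM⟩ := h Nf hNf reg ⟨hMS, hX⟩
  exact ⟨M, fun t ht => hM t ht⟩

/-- **`QCDOf N_f` for the regularisation X₀ hands over, from the six stubs.** [folklore] -/
theorem qcdOf_of_stubs (hNf : Nf = 2 ∨ Nf = 3) (reg : QCDRegularisation Nf) (hMS : reg.HasMassScaling)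
    (hX : HonestDataAboveZero reg) : QCDOf Nf := by
  have hne : (gappedOffsets reg).Nonempty := gappedOffsets_nonempty stub_heavyHalf hNf reg hMS hX
  have hpin : HonestDataAboveZero (shiftReg reg (sInf (gappedOffsets reg))) :=
    stub_pinnedData Nf hNf reg hMS hX hne
  have hchi : (shiftReg reg (sInf (gappedOffsets reg))).IsChiralAtZero :=
    pin_isChiralAtZero_of_anomaly hNf reg hpin (stub_wardTripleAtPin Nf hNf reg hMS hX hne)
      stub_uniformGapFarMomentsLV stub_farMomentsBoundGerm stub_anomalyGermVanishes
  have hdata : HonestGappedDataAbove reg (sInf (gappedOffsets reg)) :=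
    honestGappedDataAbove_of_pinnedData reg hne hpin
      (fun t ht z shift T hA => stub_latticeToSpeciesCS Nf hNf reg hMS hX t ht z shift T hA)
  exact qcdOf_of_pin reg hMS hne hchi hdata

/-- **The crux BY NAME.** [folklore] -/
theorem RobustYangMillsHandover_of :
    Summit.QuantumFields.QCD.Theses.HeatSlicedQuarks.RobustYangMillsHandover := by
  intro hX
  have key : ∀ Nf, (Nf = 2 ∨ Nf = 3) → QCDOf Nf := by
    intro Nf hNf
    obtain ⟨reg, hMS, hb⟩ := hX Nf hNf
    exact qcdOf_of_stubs hNf reg hMS hb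
  exact ⟨key 2 (Or.inl rfl), key 3 (Or.inr rfl)⟩

/-! ## §5 Sanity links and the two round-2 certificates (sorry-free, not registered) -/

/-- A single NON-gapped offset tuple bounds the gapped offsets below (gen-2 Goldstone input I; no longer on the registered
path). [folklore] -/
theorem bddBelow_of_not_latticeGappedAt (reg : QCDRegularisation Nf) {t₀ : Fin Nf → ℝ}
    (h : ¬ LatticeGappedAt reg t₀) : BddBelow (gappedOffsets reg) := by
  obtain ⟨L, hL⟩ : ∃ L : ℝ, ∀ f, L < t₀ f := by
    rcases isEmpty_or_nonempty (Fin Nf) with hE | hN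
    · exact ⟨0, fun f => (hE.false f).elim⟩
    · obtain ⟨f₀, -, hf₀⟩ := Finset.exists_min_image Finset.univ t₀ Finset.univ_nonempty
      exact ⟨t₀ f₀ - 1, fun f => by linarith [hf₀ f (Finset.mem_univ f)]⟩
  refine ⟨L, fun M hM => ?_⟩
  by_contra hlt
  push Not at hlt
  exact h (hM t₀ fun f => lt_trans hlt (hL f))

/-- **Chirality of the pinned regularisation IS "no uniform lattice rate above the pin"** (for any offset `P`).
[folklore] -/
theorem isChiralAtZero_shiftReg_iff (reg : QCDRegularisation Nf) (P : ℝ) :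
    (shiftReg reg P).IsChiralAtZero ↔
      ¬ ∃ ε > (0 : ℝ), ∀ t : Fin Nf → ℝ, (∀ f, P < t f) → (reg.scheme t 0 0).HasLatticeMassGap ε := by
  unfold QCDRegularisation.IsChiralAtZero
  simp only [shiftReg_scheme]
  push Not
  constructor
  · intro h ε hε
    obtain ⟨m, hm, hng⟩ := h ε hε
    exact ⟨fun f => P + m f, fun f => by linarith [hm f], hng⟩
  · intro h ε hε
    obtain ⟨t, ht, hng⟩ := h ε hε
    refine ⟨fun f => t f - P, fun f => by linarith [ht f], ?_⟩
    have ht' : (fun f => P + (t f - P)) = t := funext fun f => by ring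
    rwa [ht']

/-- Transparency (a2): with non-empty, bounded-below gapped offsets, `OpensBelow reg` holds iff there is NO uniform
lattice rate at the tuples above the infimum. [folklore] -/
theorem opensBelow_iff_noUniformRateAbovePin (reg : QCDRegularisation Nf) (hne : (gappedOffsets reg).Nonempty)
    (hbdd : BddBelow (gappedOffsets reg)) :
    OpensBelow reg ↔
      ¬ ∃ ε > (0 : ℝ), ∀ t : Fin Nf → ℝ, (∀ f, sInf (gappedOffsets reg) < t f) →
        (reg.scheme t 0 0).HasLatticeMassGap ε := by
  set P := sInf (gappedOffsets reg) with hP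
  constructor
  · rintro hopen ⟨ε, hε, huni⟩
    obtain ⟨δ, hδ, hslab⟩ := hopen P ⟨ε, hε, huni⟩
    have hmem : P - δ / 2 ∈ gappedOffsets reg := fun t ht => hslab t fun f => by linarith [ht f]
    have := csInf_le hbdd hmem
    linarith
  · intro hno M hM
    obtain ⟨ε, hε, hgap⟩ := hM
    rcases le_or_gt M P with hle | hlt
    · exact absurd ⟨ε, hε, fun t ht => hgap t fun f => lt_of_le_of_lt hle (ht f)⟩ hno
    · refine ⟨(M - P) / 2, by linarith, fun t ht => latticeGappedAt_of_above_sInf reg hne t fun f => ?_⟩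
      linarith [ht f]

/-- **Gen 2's interface is now a corollary**: chirality at the pin (from the anomaly stubs) gives `OpensBelow reg`
whenever the gapped offsets are non-empty — bounded below or not. [folklore] -/
theorem opensBelow_of_chiralAtPin (reg : QCDRegularisation Nf) (hne : (gappedOffsets reg).Nonempty)
    (hchi : (shiftReg reg (sInf (gappedOffsets reg))).IsChiralAtZero) : OpensBelow reg := by
  have hno := (isChiralAtZero_shiftReg_iff reg _).mp hchi
  intro M hM
  obtain ⟨ε, hε, hgap⟩ := hM
  rcases le_or_gt M (sInf (gappedOffsets reg)) with hle | hlt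
  · exact absurd ⟨ε, hε, fun t ht => hgap t fun f => lt_of_le_of_lt hle (ht f)⟩ hno
  · refine ⟨(M - sInf (gappedOffsets reg)) / 2, by linarith, fun t ht =>
      latticeGappedAt_of_above_sInf reg hne t fun f => ?_⟩
    linarith [ht f]

/-- **Certificate 1 (the line's name): Lee–Yang openness ⇒ `OpensBelow`**, by the LANDED
`LeeYangCertificate.opensBelow_of_leeYangOpenness` (two-constants on the Bernstein ellipse, rate `ε(1−λ*)`). [folklore] -/
theorem opensBelow_of_leeYang (reg : QCDRegularisation Nf) (hLY : LeeYangOpenness reg) : OpensBelow reg :=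
  Summit.QuantumFields.QCD.Theorems.RobustYangMillsHandover.LeeYangCertificate.opensBelow_of_leeYangOpenness reg hLY

/-- **Certificate route to chirality** (gen 2 path, kept as a sanity link): with the gapped offsets bounded below,
`OpensBelow` gives chirality at the pin. [folklore] -/
theorem pin_isChiralAtZero_of_opensBelow (reg : QCDRegularisation Nf) (hbdd : BddBelow (gappedOffsets reg))
    (hopen : OpensBelow reg) : (shiftReg reg (sInf (gappedOffsets reg))).IsChiralAtZero := by
  set P := sInf (gappedOffsets reg) with hP
  intro ε hε
  by_contra hcon
  push Not at hcon
  have huni : ∀ t : Fin Nf → ℝ, (∀ f, P < t f) → (reg.scheme t 0 0).HasLatticeMassGap ε := by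
    intro t ht
    have h := hcon (fun f => t f - P) (fun f => by linarith [ht f])
    rw [shiftReg_scheme] at h
    have ht' : (fun f => P + (t f - P)) = t := funext fun f => by ring
    rwa [ht'] at h
  obtain ⟨δ, hδ, hslab⟩ := hopen P ⟨ε, hε, huni⟩
  have hmem : P - δ / 2 ∈ gappedOffsets reg := fun t ht => hslab t fun f => by linarith [ht f]
  have := csInf_le hbdd hmem
  linarith

/-! ## §6 Transparency (lead c6): the UNIFORM pin — where the Lee–Yang certificate alone supplies chirality

The offsets above which the lattice gap holds at ONE uniform rate form an up-set `U ⊆ gappedOffsets`.  Chirality of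
the regularisation shifted by `Q` is LITERALLY `Q ∉ U` (`isChiralAtZero_shiftReg_iff_not_mem_uniformlyGapped`); so at
the uniform pin `Q = sInf U` chirality is "`U` has no least element", and the line's name-giving certificate delivers
exactly that: `LeeYangOpenness reg` makes `U` open from below (`uniformlyGapped_open_of_leeYang`), hence chiral at the
uniform pin as soon as `U` is non-empty and not all of `ℝ` (`uniformPin_isChiralAtZero_of_leeYang`) — no
`BddBelow (gappedOffsets reg)` / gapless-tuple input.  What the uniform pin costs instead: its heavy half is a UNIFORM
heavy gap (`U.Nonempty`: one rate above some threshold), which item 8922 (pointwise rates) does not state, and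
`U ≠ ℝ` (some offset admits no uniform rate above it: the weakest Goldstone input).  Recorded for the planners; the
registered path (§1–§4) is unchanged. -/

/-- Offsets above which the lattice theory of `reg` is gapped at ONE uniform rate.  An up-set. -/
def uniformlyGappedOffsets (reg : QCDRegularisation Nf) : Set ℝ :=
  {M | ∃ ε > (0 : ℝ), ∀ t : Fin Nf → ℝ, (∀ f, M < t f) → (reg.scheme t 0 0).HasLatticeMassGap ε}

/-- Uniformly gapped offsets are gapped offsets. [folklore] -/
theorem uniformlyGappedOffsets_subset (reg : QCDRegularisation Nf) :
    uniformlyGappedOffsets reg ⊆ gappedOffsets reg := by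
  rintro M ⟨ε, hε, hM⟩ t ht
  exact ⟨ε, hε, hM t ht⟩

/-- `uniformlyGappedOffsets` is an up-set. [folklore] -/
theorem uniformlyGappedOffsets_upper {reg : QCDRegularisation Nf} {M M' : ℝ}
    (hM : M ∈ uniformlyGappedOffsets reg) (h : M ≤ M') : M' ∈ uniformlyGappedOffsets reg := by
  obtain ⟨ε, hε, hgap⟩ := hM
  exact ⟨ε, hε, fun t ht => hgap t fun f => lt_of_le_of_lt h (ht f)⟩

/-- **Chirality of the shifted regularisation is non-membership in the uniformly gapped offsets.** [folklore] -/
theorem isChiralAtZero_shiftReg_iff_not_mem_uniformlyGapped (reg : QCDRegularisation Nf) (Q : ℝ) :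
    (shiftReg reg Q).IsChiralAtZero ↔ Q ∉ uniformlyGappedOffsets reg :=
  isChiralAtZero_shiftReg_iff reg Q

/-- Every tuple strictly above the infimum of the non-empty uniformly gapped offsets is lattice-gapped. [folklore] -/
theorem latticeGappedAt_of_above_uniformPin (reg : QCDRegularisation Nf)
    (hne : (uniformlyGappedOffsets reg).Nonempty) (t : Fin Nf → ℝ)
    (ht : ∀ f, sInf (uniformlyGappedOffsets reg) < t f) : LatticeGappedAt reg t := by
  obtain ⟨δ, hδ, hδm⟩ :=
    exists_pos_le_all (fun f => t f - sInf (uniformlyGappedOffsets reg)) (fun f => by linarith [ht f])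
  obtain ⟨M, hMS, hMlt⟩ := exists_lt_of_csInf_lt hne
    (show sInf (uniformlyGappedOffsets reg) < sInf (uniformlyGappedOffsets reg) + δ by linarith)
  exact uniformlyGappedOffsets_subset reg hMS t fun f => by linarith [hδm f]

/-- **Lee–Yang openness makes the uniformly gapped offsets open from below.** [folklore] -/
theorem uniformlyGapped_open_of_leeYang (reg : QCDRegularisation Nf) (hLY : LeeYangOpenness reg) {M : ℝ}
    (hM : M ∈ uniformlyGappedOffsets reg) : ∃ δ > (0 : ℝ), M - δ ∈ uniformlyGappedOffsets reg := by
  obtain ⟨ε, hε, hgap⟩ := hM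
  obtain ⟨δ₀, hδ₀, hslab⟩ := hLY M ε hε hgap
  refine ⟨δ₀, hδ₀, _, Summit.QuantumFields.QCD.Theorems.RobustYangMillsHandover.LeeYangCertificate.leeYang_rate_pos
    hε hδ₀, fun t ht => ?_⟩
  exact Summit.QuantumFields.QCD.Theorems.RobustYangMillsHandover.LeeYangCertificate.hasLatticeMassGap_of_leeYangCertificate
    reg t hδ₀ (hslab t ht)

/-- **At the uniform pin the Lee–Yang certificate alone supplies chirality**: with the uniformly gapped offsets
non-empty and not all of `ℝ` (bounded below), `LeeYangOpenness reg` makes the regularisation shifted by their infimum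
chiral at zero. [folklore] -/
theorem uniformPin_isChiralAtZero_of_leeYang (reg : QCDRegularisation Nf) (hLY : LeeYangOpenness reg)
    (hbdd : BddBelow (uniformlyGappedOffsets reg)) :
    (shiftReg reg (sInf (uniformlyGappedOffsets reg))).IsChiralAtZero := by
  rw [isChiralAtZero_shiftReg_iff_not_mem_uniformlyGapped]
  intro hmem
  obtain ⟨δ, hδ, hmem'⟩ := uniformlyGapped_open_of_leeYang reg hLY hmem
  have := csInf_le hbdd hmem'
  linarith

/-! ## §7 Transparency (lead c6, wave-1 audit of `stub_latticeToSpeciesCS`, evidence #109/#110; converse transfer LANDED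
p127662 `Literature/…/MassGapToLatticeClustering.lean`): the continuum-gap stub IS the `∃ Δ`-form of item 8923

Along the honest `(z, shift, T)` the conclusion `∃ Δ > 0, HasSpeciesCSClustering Δ` of `stub_latticeToSpeciesCS` is EQUIVALENT to
`∃ Δ > 0, T.HasMassGap Δ` (`IsQCDAlong.hasSpeciesCSClustering_iff_hasMassGap`), so the stub is, hypothesis by hypothesis, the
`∃ Δ`-form of `GradientFlowSpecies.GapTransfer` (item stmt-QuantumFields-8923) restricted to regularisation schemes, and follows from
8923 BY NAME.  It therefore inherits 8923's quantifier-order step (per-pair `∀(A,B) ∃C ∀ᶠk` lattice hypothesis versus the full-space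
gap at step `k`; Disproof §13) — recorded, not repaired: the hypothesis `LatticeGappedAt` is cut by item 8922's pointwise rates. -/

/-- The conclusion of `stub_latticeToSpeciesCS` at honest data is the continuum gap clause. [folklore] -/
theorem speciesCS_iff_continuumGap {reg : QCDRegularisation Nf} {t : Fin Nf → ℝ} {z shift : QCDField Nf → ℕ → ℝ}
    {T : OSData (QCDField Nf) 4} (hA : IsQCDAlong (reg.scheme t z shift) T) :
    (∃ Δ > (0 : ℝ), (reg.scheme t z shift).HasSpeciesCSClustering Δ) ↔ ∃ Δ > (0 : ℝ), T.HasMassGap Δ :=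
  ⟨fun ⟨Δ, hΔ, h⟩ => ⟨Δ, hΔ, hA.hasMassGap_of_hasSpeciesCSClustering h⟩,
    fun ⟨Δ, hΔ, h⟩ => ⟨Δ, hΔ, hA.hasSpeciesCSClustering_of_hasMassGap h⟩⟩

/-- **Item 8923 `GapTransfer` BY NAME implies `stub_latticeToSpeciesCS`** (with its idle hypotheses dropped). [folklore] -/
theorem latticeToSpeciesCS_of_gapTransfer (h : Summit.QuantumFields.QCD.Theses.GradientFlowSpecies.GapTransfer)
    (reg : QCDRegularisation Nf) (t : Fin Nf → ℝ) (ht : LatticeGappedAt reg t)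
    (z shift : QCDField Nf → ℕ → ℝ) (T : OSData (QCDField Nf) 4) (hA : IsQCDAlong (reg.scheme t z shift) T) :
    ∃ Δ > (0 : ℝ), (reg.scheme t z shift).HasSpeciesCSClustering Δ := by
  obtain ⟨Δ, hΔ, hL⟩ := ht
  have hL' : (reg.scheme t z shift).HasLatticeMassGap Δ := (hasLatticeMassGap_species_irrel reg t z shift Δ).mpr hL
  exact (speciesCS_iff_continuumGap hA).mpr
    ⟨Δ / 2, by positivity, h Nf _ T Δ (Δ / 2) (by positivity) (by linarith) hA hL'⟩

/-- Sanity link: the crux IS the arrow §4 concludes, with the re-typed consequent. [folklore] -/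
theorem robustYangMillsHandover_iff :
    Summit.QuantumFields.QCD.Theses.HeatSlicedQuarks.RobustYangMillsHandover ↔
      (ContinuumQCDExists → QCDOf 2 ∧ QCDOf 3) :=
  Iff.rfl

/-! ## §8 Transparency (lead c7): the mechanism of `stub_uniformGapTreeDecayCentered` — what is and is not missing

c6's wave-1 audit (evidence 21:42Z) listed seven missing pieces M1–M7 for this stub (M1 trace formula for the periodic
`qcdTorusExpect`, M2 Lüscher positivity, M3 spectral-gap extraction from the per-pair `HasLatticeMassGap`, M4 hypercubic and
M5 translation covariance [landed p128833/p129145, p128004], M6 `(−1)^F` wrap-around, M7 tree-decay combinatorics).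

**M3 is not needed; M7 is the two lemmas below.**  Cut the centred three-point function `⟨V_μ(x) V_ν(y) P(0)⟩` by a
hyperplane orthogonal to the axis `i` that carries the largest coordinate of `x, y` (`exists_gap_of_three`: one of the two
consecutive gaps of the three `i`-coordinates is at least half their span, and the span is `≥ max ‖·‖/2` in four
dimensions), isolating ONE observable `F ∈ {P, V_μ, V_ν}` from the PAIR `G` of the other two.  In any transfer/OS realisation
of the functional along that axis (M1; M4 turns the time axis into the axis `i`, M5 moves the cut to the reflection
hyperplane) the three-point function is `⟪ι(θF̄), T^g ι G⟫` with `g` the gap, and the centring clause `⟨F⟩ = 0` kills the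
truncation term, so the landed engine gives (`threePoint_le_of_centred`, abstract form)
`|⟨F · G_g⟩| ≤ √(Re⟨θF̄ · F_g⟩ − |⟨F⟩|²) · √(⟨θḠ · G⟩ − |⟨G⟩|²)`.  The first factor is the DIAGONAL connected two-point function
of the single observable `F` — five pairs `(θŌ, O)`, `O ∈ {V_μ, P}`, so the per-pair `∃ C ∀ᶠ k` of `HasLatticeMassGap ε`
costs ONE threshold `k₀` — and decays like `e^{−ε a_k g/2}`; the second is the stub's own hypothesis (uniform truncated
reflected pair bounds, `(a_k + ‖x − y‖)^{−σ}` after the square root).  No spectral gap of the step-`k` transfer matrix is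
ever extracted, so the quantifier step G4 of 8923 (Disproof §13) does not arise here.

**What does remain (M1+M6, recorded, not repaired).**  The functional of the stub — and of `HasLatticeMassGap`,
`IsChiralAtZero`, items 16260/16261 — is the finite-torus `qcdTorusExpect` with the tree's time-PERIODIC `wilsonDirac`: by
Lüscher's trace formula it is the `(−1)^F`-TWISTED trace `Tr[(−1)^F 𝕋^{2S+1} ⋯]/Tr[(−1)^F 𝕋^{2S+1}]` (QCDOS docstring, audit
g8 N2), a difference of the two fermion-parity thermal functionals, hence NOT a state and not reflection positive at any
finite `S` (the tree's `WilsonQCDSiteReflectionPositivityAP` is for the ANTIPERIODIC functional `qcdTorusExpectAP`).  The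
engine needs a positive form `⟪·, T^g ·⟫`; at finite periodic `S` none is available, and the normalisation-free use of the
per-pair decay (constants `C_{A,B}` of `HasLatticeMassGap` are for UNWEIGHTED correlators, the stub's weights `u_V² ~ a_k^{−6}`
diverge) needs positivity too (log-convexity of `g ↦ ⟪v, T^g v⟫`).  So the stub is provable along this mechanism exactly
for an OS-realisable version of the functional (`S → ∞` at fixed `k`, or the antiperiodic torus functional with its
antipodal reflection positivity) — a re-typing of 16260's functional that only the `AnomalyRigidity` planner can make; as
typed (finite periodic `S`, all `x, y ∈ box S`) no proof architecture is known to this lead, and no constructible witness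
refutes it (c6).  `## Census` carries the same. -/

/-- **The tree in "tree decay"** (M7, one-dimensional form): among three real coordinates `0, p, q` one of the two
consecutive gaps is at least half of `max |p| |q|`: there is a threshold `θ` and a side such that one of the three points
lies at distance `≥ max |p| |q| / 2` beyond `θ` while the other two lie on the other side of `θ`.  Stated as: some point `c`
of the three and the remaining two `d, e` satisfy `c + max/2 ≤ min d e` or `max d e + max/2 ≤ c`. [folklore] -/
theorem exists_gap_of_three (p q : ℝ) :
    ∃ c d e : ℝ, ({c, d, e} : Finset ℝ) = {0, p, q} ∧
      (c + max |p| |q| / 2 ≤ min d e ∨ max d e + max |p| |q| / 2 ≤ c) := by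
  -- WLOG `|q| ≤ |p|` by symmetry of the statement in `p, q`
  wlog hpq : |q| ≤ |p| generalizing p q with H
  · obtain ⟨c, d, e, hset, hgap⟩ := H q p (le_of_not_ge hpq)
    refine ⟨c, d, e, ?_, ?_⟩
    · rw [hset]; ext x; simp only [Finset.mem_insert, Finset.mem_singleton]; tauto
    · rwa [max_comm] at hgap
  rw [max_eq_left hpq]
  -- the span of `{0, p, q}` is at least `|p|`; `q` splits `[min 0 p, max 0 p]` or lies outside
  rcases le_or_gt 0 p with hp | hp
  · rw [abs_of_nonneg hp] at hpq ⊢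
    -- `0 ≤ p`, `|q| ≤ p`
    rcases le_or_gt q (p / 2) with hq | hq
    · -- isolate `p` on the right: the pair `{0, q}` lies below `p/2`… unless `q < 0`, still below
      refine ⟨p, 0, q, by ext x; simp only [Finset.mem_insert, Finset.mem_singleton]; tauto, Or.inr ?_⟩
      rcases le_or_gt q 0 with hq0 | hq0
      · rw [max_eq_left hq0]; linarith
      · rw [max_eq_right hq0.le]; linarith
    · -- `p/2 < q ≤ p`: isolate `0` on the left, pair `{p, q}`
      refine ⟨0, p, q, rfl, Or.inl ?_⟩
      rw [min_eq_right (by linarith [abs_le.mp (show |q| ≤ p from hpq)])]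
      linarith
  · rw [abs_of_neg hp] at hpq ⊢
    -- `p < 0`, `|q| ≤ -p`
    rcases le_or_gt (p / 2) q with hq | hq
    · -- isolate `p` on the left, pair `{0, q}` above `p/2`
      refine ⟨p, 0, q, by ext x; simp only [Finset.mem_insert, Finset.mem_singleton]; tauto, Or.inl ?_⟩
      rcases le_or_gt 0 q with hq0 | hq0
      · rw [min_eq_left hq0]; linarith
      · rw [min_eq_right hq0.le]; linarith
    · -- `-(-p) ≤ q < p/2`: isolate `0` on the right, pair `{p, q}`
      refine ⟨0, p, q, rfl, Or.inr ?_⟩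
      rw [max_eq_right (by linarith [abs_le.mp (show |q| ≤ -p from hpq)])]
      · linarith [abs_le.mp (show |q| ≤ -p from hpq)]

/-- In four dimensions the largest coordinate carries a quarter of the Euclidean norm: for `x : Fin 4 → ℝ` (read in
`EuclideanSpace ℝ (Fin 4)`) some `|x i| ≥ ‖x‖ / 2`. [folklore] -/
theorem exists_coord_ge_half_norm (x : EuclideanSpace ℝ (Fin 4)) : ∃ i : Fin 4, ‖x‖ / 2 ≤ |x i| := by
  by_contra h
  push Not at h
  have hsum : ‖x‖ ^ 2 = ∑ i : Fin 4, |x i| ^ 2 := by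
    rw [EuclideanSpace.norm_eq, Real.sq_sqrt (Finset.sum_nonneg fun i _ => sq_nonneg _)]
    simp only [Real.norm_eq_abs, sq_abs]
  have hlt : ∑ i : Fin 4, |x i| ^ 2 < ∑ _i : Fin 4, (‖x‖ / 2) ^ 2 := by
    refine Finset.sum_lt_sum_of_nonempty Finset.univ_nonempty fun i _ => ?_
    have h0 : 0 ≤ |x i| := abs_nonneg _
    exact pow_lt_pow_left₀ (h i) h0 two_ne_zero
  simp only [Finset.sum_const, Finset.card_univ, Fintype.card_fin, nsmul_eq_mul] at hlt
  nlinarith [hsum, hlt, norm_nonneg x]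

/-- **The three-point bound from the landed engine, abstract form** (`TransferTruncatedSchwarzBound`, p129979): in
transfer data `(T, Ω)`, for a CENTRED isolated vector `a` (`⟪Ω, a⟫ = 0` — the centring clauses of the stub; without them
`V = P = 1` is the counterexample of the 18:44Z review of 16260) and any pair vector `p`, the "three-point function"
`⟪a, T^g p⟫` is at most `√(Re⟪a, T^g a⟫) · √(‖p‖² − |⟪Ω, p⟫|²)`: the diagonal two-point function of the single observable at
the gap `g` times the truncated pair norm.  No spectral gap of `T` enters. [cite: GlimmJaffe1987, §6.1 Thm. 6.1.3] -/
theorem threePoint_le_of_centred {H : Type*} [NormedAddCommGroup H] [InnerProductSpace ℂ H] [CompleteSpace H]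
    (D : Literature.Probability.LatticeModels.TransferData H) {a : H} (ha : inner ℂ D.vacuum a = 0) (p : H) (g : ℕ) :
    ‖inner ℂ a ((D.T ^ g) p)‖ ≤
      Real.sqrt (RCLike.re (inner ℂ a ((D.T ^ g) a))) * Real.sqrt (‖p‖ ^ 2 - ‖inner ℂ D.vacuum p‖ ^ 2) := by
  have h := D.norm_inner_pow_sub_le_sqrt_mul_sqrt a p g
  have ha' : inner ℂ a D.vacuum = 0 := by rw [← inner_conj_symm, ha, map_zero]
  rw [ha', zero_mul, sub_zero, ha, norm_zero] at h
  simpa using h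

/-! ## §9 Transparency (lead c8): the two engines and the FINITE-TORUS audit of `stub_uniformGapTreeDecayCentered` / item 16260

**(a) Infinite time extent — c7's second positivity use is discharged** (p131005).  In an OS realisation
(`TransferData` / `IsOSRealisation`: positive contraction `T`, vacuum `Ω`) the per-pair clustering hypothesis for the
single observable `F` — `‖⟪a, Tⁿ a⟫ − ⟪a,Ω⟫⟪Ω,a⟫‖ ≤ K rⁿ` EVENTUALLY, with its own constant `K = C_{θF̄,F}` and threshold,
`a = ι F` — forces, by log-convexity of `n ↦ ⟪a, Tⁿ a⟫`, the one-step ratio bound for EVERY `n` and therefore decay from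
any starting separation `g₀` with the honest constant `re ⟪a, T^{g₀} a⟫` (for a centred `a` this is the diagonal
reflected pair quantity that the stub's hypothesis hU2 bounds m-uniformly at physical time `τ = a_k g₀`, weights
included).  Combined with c7's cut (`threePoint_le_of_centred`): `threePoint_le_of_centred_of_eventually` below — the
weights never meet the per-pair constant.  So in infinite time extent the mechanism of §8 is complete but for the
geometry M7' (below) and the realisation itself.

**(b) Finite tori — the stub's actual setting** (`∀ S ≥ L_k`, binding case `S = L_k`).  Three findings.

(b1) *The Schwarz step needs no transfer operator for the ANTIPERIODIC functional.*  The tree PROVES site-reflection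
positivity of `qcdTorusExpectAP` at every finite odd side (`WilsonQCDSiteReflectionPositivityAP_holds`, β ≥ 0,
`m_f > −1`): for an AP re-typing of 16260 the cut `|⟨θF̄ · G⟩| ≤ √⟨θF̄ F⟩ √⟨θḠ G⟩` is available at finite `S` as is, and
log-convexity of `n ↦ ⟨θF̄ · τ_{2n} F⟩` (even separations) follows from RP about translated site planes, i.e. RP plus
time-translation covariance of the AP functional on fermion-even observables (the landed p128004 is the periodic case).
c6/c7's M1 (Lüscher's trace formula) is thus not on the critical path of an AP re-typing; for the PERIODIC functional of
the stub as typed nothing replaces it (twisted trace, §8).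

(b2) *Per-pair constants versus weights at antipodal separations: a volume growth-rate condition is missing.*  On the
torus of side `2S+1` the diagonal correlator `f(n)` (weighted: `u_k² ×` connected `⟨θŌ · τ_n O⟩`) is log-convex only on
`n ≤ S`, and the ratio argument of (a) — which lets `n → ∞` — is unavailable: the transfer matrix of spatial volume `S` is
probed by `HasLatticeMassGap` only up to `n = S` (larger tori are DIFFERENT transfer matrices on hypercubic tori).  What
survives is the chord (p131329 `le_mul_pow_of_logConvexOn`): from `f(n₀) ≤ A` (hU2 at `τ = a_k n₀`) and the endpoint
bound `f(S) ≤ W_k e^{−ε a_k S}` with the WEIGHTED per-pair constant `W_k := u_k² C_{θŌ,O}`,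
`f(n) ≤ max A 1 · max (W_k e^{−(ε−ε') a_k (S−n₀)}) 1 · e^{−ε' a_k (n−n₀)}` — m-uniform decay at any rate `ε' < ε` holds
iff `log W_k ≤ (ε − ε') a_k (L_k − n₀) + O(1)` eventually in `k`.  For canonically normalised fields `W_k ~ a_k⁻⁶`, so the
condition reads `a_k L_k / log a_k⁻¹ → ∞`: volumes super-logarithmic in the cutoff.  Neither item 16260 (weights `u`
arbitrary, tied to the observables only through hU2, which is scale-invariant under `(V,u) ↦ (λV, u/λ)` exactly like
`u² C`) nor `QCDRegularisation` (`a_k L_k → ∞` at no rate) states it.  It is NOT an artefact of the chord: abstract spectral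
data of the stub's SHAPE — at volume `L_k` one extra mode with `λ = 1` whose UNWEIGHTED amplitude `C e^{−ε a_k L_k}` is
invisible to the per-pair clause at `n ≤ S = L_k` while its WEIGHTED amplitude is `O(1)` (allowed by hU2) — meet every
hypothesis and put an `O(1)` floor under the weighted correlator at antipodal separation, against the required
`e^{−ε' a_k L_k / 2}`, precisely when `log W_k ≳ ε a_k L_k`.  Only dynamical information about lattice QCD at volume `L_k`
(no such light finite-volume modes) could replace the condition — i.e. nothing short of the gap problem itself.  Cheap
repair for route `AnomalyRigidity` (free in the `∃ reg` statement 16259, then hypotheses of 16260): (H-vol)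
`Tendsto (fun k ↦ a k * L k / Real.log (a k)⁻¹) atTop atTop` and (H-wt) `∃ p, ∀ᶠ k, |u k| ≤ (a k)⁻ᵖ` (physically `u ~ a⁻³`);
then `log W_k = O(log a_k⁻¹) = o(a_k L_k)`.  For THIS crux the pinned regularisation is X₀'s (shifted `m_crit`, same `a`,
`L`): its volumes come with no rate — after the chiral pin, the data below X₀'s offset, and the per-pair/uniform gap
order, a further datum the antecedent `ContinuumQCDExists` does not hand over (enlarging `L_k` is not allowed: `IsQCDAlong`
converges at side `2L_k+1` only; subsequences do not change `a_k L_k`).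

(b3) *Time-antiperiodicity alone breaks the hypercubic symmetry at finite `S`.*  With AP quarks in time only, RP — hence
any Schwarz cut — exists across TIME hyperplanes only, while tree decay must cut across the axis of the largest coordinate
(`exists_coord_ge_half_norm`, §8): a spatially spread triple gets no decay from the time gap at finite `S` (the symmetry
`x₀ ↔ x_i` maps the functional to one with AP in direction `i`).  The functional over which the §8 mechanism runs at finite
`S` is the ALL-DIRECTIONS-antiperiodic torus expectation: axis permutations act on it (p128833 pattern), and site-RP along
every axis is the same proof (transverse boundary conditions do not enter the slice factorisation — to be re-run).

**(c) Status and recommendation.**  `stub_uniformGapTreeDecayCentered` as typed (periodic functional; per-pair gap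
constants; volumes without rate; arbitrary weights) is not reachable by any reflection-positivity / transfer-matrix
architecture known to this lead — (b2) is decisive independently of (b1)/(b3) — and is not constructibly refutable (c6;
c8: its `β = 0` / `N_f = 0` instances are TRUE by ultralocality of the product Haar measure).  To the `AnomalyRigidity`
planner: re-type 16259(b)/16260 over the all-AP functional with (H-vol), (H-wt) and the family `{1, V_μ, P}` closed
under `osAdjoint`; 16260 then decomposes into provable pieces: RP-Schwarz cut (p129979 pattern) · even-separation
log-convexity (RP + translations) · chord under (H-vol)/(H-wt) (p131329) · axis covariance (p128833 pattern) · M7' (a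
second, lateral cut for mutually far triples: the truncated reflected norm of a far PAIR is a 4-point function, reduced to
products of hU2 quantities plus a lateral connected correction by one more Schwarz cut).  Repair option 2 (possibly cleaner, `FINDING-c8-finite-torus.md`): take the thermodynamic limit FIRST — re-type
16259(b)/16260/16261 over the infinite-volume state `ω_k = lim_S` of the torus functionals at fixed `k`: the per-pair clause
then holds for all `n` (ratio argument of p131005, no volume rate: (b2) gone), `ω_k` is RP and translation invariant (limit
of site-RP antiperiodic functionals: (b1), (b3) gone once hypercubic-symmetric), and its `IsOSRealisation` is the standard
OS/GNS reconstruction, now IN THE TREE (lead c8: p131779 `Literature/Probability/LatticeModels/OSReconstructionAbstract`,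
p131961 `…/OSReconstructionMeasure` — `isOSRealisation_of_isRPMeasureData`, `isOSRealisation_two_step`: RP measure data
⇒ honest positive transfer operator) — after which p129979 + p131005 give the tree decay.  To this crux's
planner: unchanged since c2 (restate R1/R2; every open stub here is 8922 / X₀-below-its-offset / the 8923 kernel /
Ward-anomaly physics / and now X₀'s volume rate). -/

/-- **The three-point bound with the decay upgrade, abstract form** (engines p129979 + p131005): in transfer data
`(T, Ω)`, for a CENTRED isolated vector `a` whose diagonal pair clusters EVENTUALLY at rate `r` with ANY constant `K`
(the per-pair clause of `HasLatticeMassGap` for the one pair `(θF̄, F)`), and any pair vector `p`, at every separation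
`g ≥ g₀`: `‖⟪a, T^g p⟫‖ ≤ √(re ⟪a, T^{g₀} a⟫) · (√r)^{g−g₀} · √(‖p‖² − ‖⟪Ω, p⟫‖²)` — the constant is the diagonal
correlator of `a` at the starting separation `g₀` (what hU2 controls, weights included), not `K`.
[cite: GlimmJaffe1987, §6.1 Thm. 6.1.3] -/
theorem threePoint_le_of_centred_of_eventually {H : Type*} [NormedAddCommGroup H] [InnerProductSpace ℂ H]
    [CompleteSpace H] (D : Literature.Probability.LatticeModels.TransferData H) {a : H}
    (ha : inner ℂ D.vacuum a = 0) (p : H) {r K : ℝ} (hr : 0 < r)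
    (hdec : ∀ᶠ n in atTop, ‖inner ℂ a ((D.T ^ n) a) - inner ℂ a D.vacuum * inner ℂ D.vacuum a‖ ≤ K * r ^ n)
    {g₀ g : ℕ} (hg : g₀ ≤ g) :
    ‖inner ℂ a ((D.T ^ g) p)‖ ≤
      Real.sqrt (RCLike.re (inner ℂ a ((D.T ^ g₀) a))) * Real.sqrt r ^ (g - g₀) *
        Real.sqrt (‖p‖ ^ 2 - ‖inner ℂ D.vacuum p‖ ^ 2) := by
  have h3 := threePoint_le_of_centred D ha p g
  have hup := D.re_inner_pow_sub_le_mul_pow_of_eventually a hr hdec hg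
  rw [ha, norm_zero, sq, mul_zero, sub_zero, sub_zero] at hup
  have h0 : 0 ≤ RCLike.re (inner ℂ a ((D.T ^ g₀) a)) := D.re_inner_pow_nonneg a g₀
  have hpt : Real.sqrt (r ^ (g - g₀)) = Real.sqrt r ^ (g - g₀) := by
    have hsq : r ^ (g - g₀) = (Real.sqrt r ^ (g - g₀)) ^ 2 := by
      rw [← pow_mul, mul_comm, pow_mul, Real.sq_sqrt hr.le]
    rw [hsq, Real.sqrt_sq (pow_nonneg (Real.sqrt_nonneg r) _)]
  have hsqrt : Real.sqrt (RCLike.re (inner ℂ a ((D.T ^ g) a))) ≤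
      Real.sqrt (RCLike.re (inner ℂ a ((D.T ^ g₀) a))) * Real.sqrt r ^ (g - g₀) := by
    calc Real.sqrt (RCLike.re (inner ℂ a ((D.T ^ g) a)))
        ≤ Real.sqrt (RCLike.re (inner ℂ a ((D.T ^ g₀) a)) * r ^ (g - g₀)) := Real.sqrt_le_sqrt hup
      _ = Real.sqrt (RCLike.re (inner ℂ a ((D.T ^ g₀) a))) * Real.sqrt r ^ (g - g₀) := by
          rw [Real.sqrt_mul h0, hpt]
  exact h3.trans (mul_le_mul_of_nonneg_right hsqrt (Real.sqrt_nonneg _))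

/-! ## §10 Transparency (lead c10): item 17718 against the finite-torus audit — the slow-mode bookkeeping, and why (H-vol) is free

**(a) 17718 as typed inherits §9 (b2).**  Its hypotheses, read at the abstract transfer-matrix level on the torus of side
`2S+1`, `S ≥ L_k` (vacuum `Ω`, an exactly degenerate slow state `s`, `λ_s = 1`, everything else gapped): the per-pair gap
clause `HasLatticeMassGap ε` for UNWEIGHTED observables bounds every overlap of a local observable with `s` by
`|⟨s|A Ω⟩|² ≤ C_A e^{−ε a_k S}` (pair `(A†, A)` at separation `n = S`); the weighted truncated reflected pair bounds (the
hypothesis shared with 17716(b)) bound the WEIGHTED overlaps, `u_V² |⟨s|V V Ω⟩| ≤ √C`, `u_P |⟨s|P Ω⟩| ≤ √C`,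
`u_V |⟨s|V Ω⟩| ≤ √C`; centring is `⟨Ω|V Ω⟩ = ⟨Ω|P Ω⟩ = 0`; asymptotic scaling and the physical branch do not speak of
`s`.  The slow contribution to the weighted three-point function `u_V² u_P ⟨V(x) V(y) P(0)⟩` is the product of two
weighted overlaps, hence `O(1)` POINTWISE (Cauchy–Schwarz through `s`, no volume condition needed — the pointwise content of
16260/17718 is not obstructed at the level of size) but WITHOUT any decay in `max(|ξ|,|η|)`; both caps are attained
simultaneously iff `u_V(k), u_P(k) ≥ e^{ε a_k S/2}`.  The far-region L¹ moment of a non-decaying `O(1)` term over `box²`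
is `≍ (a_k S)^{8+i+j}`, unbounded.  So for weights `u(k) ≥ e^{ε a_k L_k/2}` the hypotheses' SHAPE admits a scenario
defeating the conclusion at `S = L_k`; for `log |u(k)| ≪ ε a_k L_k` the slow contribution at `S ≥ L_k` is
`≤ C u³ e^{−ε a_k S} (a_k S)^{12} → 0` and the scenario is harmless.  17718 states no relation between `u` and `a_k L_k`
(`QCDRegularisation.tendsto_L`: `a_k L_k → ∞` at an arbitrary rate; the weights are free sequences), hence is not provable
from hypotheses of its shape by any spectral / RP architecture — exactly lead c8's verdict on 16260ᶜ, unchanged by the L¹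
form, the centring, `N_f` or asymptotic scaling.  (Classical label-mixture models cannot realise the scenario — in them the
`(P,P)` four-point overlap is tied to the square of the `P` overlap and a factor `w^{1/4} = e^{−ε a_k S/4}` is always lost —
so no CONSTRUCTIBLE counterexample is claimed; the functional is the honest `qcdTorusExpect` anyway.)

**(b) The repair (H-vol) and why it costs nothing.**  `UniformGapFarMomentsLV` adds
`a_k L_k / log (2 + a_k⁻¹ + |u_V(k)| + |u_P(k)|) → ∞`, under which `u³ a⁻ᵖ (a_k S)^{12} e^{−ε' a_k S} → 0` on `S ≥ L_k` for
every `ε' > 0`, `p` — what the intended proof (thermodynamic limit by RP transfer matrices at fixed `k`, m-uniform decay there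
by the landed engines p129979/p131005, exponential finite-size corrections on `S ≥ L_k`) spends at its last step.  The
hypothesis is FREE for every consumer because the whole chain is monotone under enlarging volume thresholds: each hypothesis of
17718/17719 and of `WardTripleDataCentered` is `∀ᶠ k, ∀ S ≥ L_k, …` (`eventually_forall_ge_mono`), the gap clause fed in
by `¬ IsChiralAtZero reg` likewise, asymptotic scaling / physical branch / the germ conclusion of 17719 do not mention `L`,
and thresholds `L'_k ≥ L_k` with (H-vol) always exist (`exists_superlogVolume`: `L'_k = max L_k ⌈log²(…)/a_k⌉`).  §3
`isChiralAtZero_of_wardTripleDataCentered` IS that argument, kernel-checked: it runs the rev-6 deciding chain on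
`enlargeL reg L'` and concludes `reg.IsChiralAtZero`.  Recommendation to the `AnomalyRigidity` planner: restate 17718 as
`UniformGapFarMomentsLV` (rev 7); `closes` is repaired by the same twenty lines. -/

end

end Summit.QuantumFields.QCD.Cruxes.RobustYangMillsHandover.LeeYangMassHandover
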